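import Mathlib
import HarnessLib
import HarnessLib.Audit
import Summits.QuantumAdvantage.Statement
import Summits.QuantumAdvantage.AdviceFreeQNC0.SparseOfGap
import Summits.QuantumAdvantage.AdviceFreeQNC0.OddPrimeLadder
import Summits.QuantumAdvantage.AdviceFreeQNC0.EliminationHardnessF
import Summits.QuantumAdvantage.AdviceFreeQNC0.WalkHardFAnchored
import Summits.QuantumAdvantage.AdviceFreeQNC0.AdviceFreeQNC0Odd
import Summits.QuantumAdvantage.QuantumAdvantage.Theorems.WalkNoPerfectLinSel
import Summits.QuantumAdvantage.QuantumAdvantage.Theorems.WalkNoPerfectKForm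
import Summits.QuantumAdvantage.QuantumAdvantage.Theorems.OddPrimeWalkLinTestsOdd
import Summits.QuantumAdvantage.QuantumAdvantage.Theorems.OddPrimeWalkCounterAffinePairLaw
import Summits.QuantumAdvantage.QuantumAdvantage.Theorems.OddPrimeWalkRegisterRigidityReduction
import Summits.QuantumAdvantage.QuantumAdvantage.Theorems.OddPrimeWalkThreeBlindBits
import Summits.QuantumAdvantage.QuantumAdvantage.Theorems.OddPrimeWalkFourBlindBitsInnerNull
import Summits.QuantumAdvantage.QuantumAdvantage.Theorems.OddPrimeWalkCounterRungs
import Summits.QuantumAdvantage.QuantumAdvantage.Theorems.OddPrimeWalkBoundedJuntaRung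
import Summits.QuantumAdvantage.QuantumAdvantage.Theorems.OddPrimeWalkColumnResolutionRung
import Summits.QuantumAdvantage.QuantumAdvantage.Theorems.OddPrimeWalkFibreTwistBound
import Summits.QuantumAdvantage.QuantumAdvantage.Theorems.OddPrimeWalkSignWalkFloor
import Summits.QuantumAdvantage.QuantumAdvantage.Theorems.OddPrimeWalkHiddenCoinsFourOdd
import Summits.QuantumAdvantage.QuantumAdvantage.Theorems.OddPrimeWalkLinFormsSqrtOdd
import Summits.QuantumAdvantage.QuantumAdvantage.Theorems.WalkFiniteStateRung
import HarnessLib.Audit.Status.Attr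

/-!
Route: OddPrimeWalk

# Route OddPrimeWalk — Advice-free QNC0 beats FAC0[p], p at least 5, because low-degree Fp players
cannot steer the mod-3 u-walk game

RUNG ROUTE (D-0059/D-0145 registration of the cell qa-qnc0 odd-prime line, rung F-Q2-odd; the
deciding theorem concludes the rung leaf
`LeafOdd := ∀ p prime, 5 ≤ p → AdviceFreeQNC0Sep p` (advice-free QNC⁰ ⊄ FAC⁰[p] with uniform shared
randomness, for a relation family),
which is NOT the summit Statement (BQP vs BPP untouched) and is not yet a registered alt-closer: the
route is born draft and is re-pointed with
`--closes-target` once the operator mints the leaf). It suffices to show `WalkHardF p` for every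
prime p ≥ 5: some θ < 1 such that for every C, for
all large n, every charge c and every strategy y (one Boolean output per cut g ≤ n, each of
𝔽_p-degree ≤ (log₂ n)^C) wins the u-walk game `ringWinU c y`
(an odd number of fired cuts g with c + g + |u| + |u_<g| ≢ 0 mod 3) on at most θ·2ⁿ inputs u. X =
X_shots ∧ X_dense: X_shots = `ShotsOdd` (strategies
firing ≤ B cuts on EVERY input, B³(log₂ n)^{2C+2} ≤ n — per-input sparsity, positions arbitrary and
adaptive) and X_dense = `DenseResidualOdd` (the
complement regime); the dichotomy glue and the landed ladder `WalkHardF p → AdviceFreeQNC0Sep p`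
(tree `adviceFreeQNC0Sep_of_walkHardF`) finish.
Lean: `∀ (p : ℕ) [Fact p.Prime], 5 ≤ p → Summit.QuantumAdvantage.AdviceFreeQNC0.WalkHardF p`

## Assembly
Pure logic (glue.lean): `closes (hSh : ShotsOdd) (hR : DenseResidualOdd) (hG : DichotomyGlue) (hB :
BridgeOdd) : ∀ p [Fact p.Prime], 5 ≤ p → AdviceFreeQNC0Sep p
:= fun p _ hp => hB p hp (hG hSh hR p hp)` — the glue case-splits every strategy into the shots
regime (ShotsOdd) or the residual, giving `WalkHardF p`,
and the landed ladder gives the leaf. Binders: ShotsOdd, DenseResidualOdd, DichotomyGlue, BridgeOdd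
(BC6: declared 8 / in-cone 4 / aside 4 —
GapOdd, SparseOdd, ElimHardFOdd, AnchoredOdd are banked rungs, the citable tokens of the provers
already landing them).

CLOSES_TARGET: closes rung F-Q1-odd of QuantumAdvantage: Summit.QuantumAdvantage.AdviceFreeQNC0.AdviceFreeQNC0Odd (D-0061; not the summit Statement) — the deciding theorem of this route concludes that registered leaf instead of the Statement decl `QuantumAdvantage` (class rung: servable and labelled, never counted as concluding the summit Statement).

Rationale: WHY THIS LINE. On the n-cycle, BGK's relation is «bet a parity against a hidden mod-3 residue» (tree
`rel_iff_ringWinU`, `avoidNormalForm`): in u-coordinates a strategy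
accumulates a register M(u) ∈ (ℤ/2)³/⟨111⟩ ≅ V₄ by firing cuts whose hidden labels are states of the
mod-3 walk W_g = g + |u_<g|, and wins iff M ≠ 0 and
the odd coordinate of M differs from σ = c + |u| mod 3 — an ELIMINATION game against |u| mod 3 (tree
`chargePair`, `twoSpeedLoses`). For p = 2 the XOR
register is native and the tube argument proves `WalkHardF 2` (tree `walkHardF_two`); for p = 3 the
walk is visible and the game is easy (tree
`not_walkHardF_three`); for p ≥ 5 three moduli {p, 2, 3} meet. The line imports the polynomial
method (Smolensky 1987; Srinivasan's robust Hegedűs lemma,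
doi:10.46298/theoretics.23.5, ported to 𝔽_p by the cell as
`lowDegAvoidMod3SparseF`/`elimLevelSqrtF`) and adds ONE mechanism: fibre over a cut-free bit
interval, where every fired cut's label is affine in t = |u_E| mod 3 with speed 1 (left) or 2
(right), so the two-speed charge argument names a losing
residue whose level sets have 𝔽_p-degree ≤ (#shots)·D — and per-input sparsity ≤ B is made cut-free
by a random surgery costing B·L/n. What is new
relative to print (BGK18 arXiv:1704.00690, WKST19 arXiv:1906.08890, GK24 arXiv:2408.16406 all use
advice/cat states or p = 2): advice-free, odd p;
relative to the negatives index: nothing there concerns this game.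

RANKED CRUXES. #2 DenseResidualOdd (crux) — For every prime p ≥ 5 there is θ < 1 such that for all C
and all large n, every 𝔽_p-degree-(log₂ n)^C strategy whose maximal number of shots per input b
satisfies b³(log₂ n)^{2C+2} > n wins `ringWinU c y` on at most θ·2ⁿ inputs (the dense-per-input
residual of `WalkHardF p`). [difficulty: open-problem] (why it might fail: a dense player XORs ≳
n^{1/3} hidden-label shots; any test-oblivious proof yields a CDH-type MOD₂∘MOD_p∘AND bound (BST90,
open for fan-in ≥ 2) — true-but-out-of-reach, or false via a walk-specific dense trick.)
[arXiv:2311.17440, arXiv:1906.08890, arXiv:2408.16406, doi:10.46298/theoretics.23.5]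
#4 ShotsOdd (crux) — For every prime p ≥ 5 there is θ < 1 such that for all C and all large n, every
𝔽_p-degree-(log₂ n)^C strategy firing at most B cuts on every input, with B³(log₂ n)^{2C+2} ≤ n,
wins `ringWinU c y` on at most θ·2ⁿ inputs (per-input-sparse rung; subsumes the landed
`TwoShotHardF` (B = 2) and `WalkHardFSparse`). [difficulty: M] (why it might fail: the surgery (zero
the shots inside one of ⌊n/L⌋ intervals, cost ≤ B·L/n) and the truncated inclusion–exclusion bound
1_{F(z)=Y₀} ∈ lowDeg(B·D) must hold in ONE fibre; a slip in the two-speed exponent at the interval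
ends forces a restatement (not a collapse).) [doi:10.46298/theoretics.23.5, arXiv:1704.00690]
#9 DichotomyGlue (support) — `ShotsOdd → DenseResidualOdd → ∀ p ≥ 5, WalkHardF p`: θ := max θ₁ θ₂,
n₀ := max, and for each strategy the case split on b³(log₂ n)^{2C+2} ≤ n with B := the maximal shot
count (`Finset.univ.sup`, `Finset.le_sup`). [difficulty: provable-now] [arXiv:1704.00690]
#9 BridgeOdd (support) — the odd-prime ladder `WalkHardF p → AdviceFreeQNC0Sep p` for p ≥ 5 — PROVED
in the tree (`AdviceFreeQNC0.adviceFreeQNC0Sep_of_walkHardF`, OddPrimeLadder.lean p564188; one line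
closes the item). [difficulty: provable-now] [arXiv:1704.00690, arXiv:1906.08890]
#9 GapOdd (support) — ASIDE (banked, rung R3, prover qn-prover-3 g8 kernel-done in dev):
`WalkHardFGap p` for p ≥ 5 — a strategy with s potentially-active cuts and a cut-free bit interval
of length L ≥ s²(log₂ n)^{2C+2} wins ≤ θ·2ⁿ; its fibre/naming lemmas are the engine of `ShotsOdd`.
[difficulty: provable-now] [doi:10.46298/theoretics.23.5]
#9 SparseOdd (support) — ASIDE (banked, rung R4): `WalkHardFSparse p` for p ≥ 5 (s
potentially-active cuts, s³(log₂ n)^{2C+3} ≤ n) — from `GapOdd` by the landed `sparseOfGap`; a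
special case of `ShotsOdd`. [difficulty: provable-now] [doi:10.46298/theoretics.23.5]
#9 ElimHardFOdd (support) — ASIDE (banked; LANDED p567244 `elimHardF (p) (hp3 : p ≠ 3)`, prover
qn-prover g10 — closes by one line): for p ≥ 5 no function with polylog-degree 𝔽_p level sets avoids
|u| mod 3 (`ElimHardF p`); the input of every fibre argument of this route. [difficulty:
provable-now] [doi:10.46298/theoretics.23.5, arXiv:2202.04982]
#9 AnchoredOdd (support) — ASIDE (banked, rung R2; defs LANDED p568202, proof p568925 in the gate,
prover qn-prover g10): strategies whose potentially-active cuts lie in one window of length (log₂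
n)^C win ≤ θ·2ⁿ (`WalkHardFAnchored p`, p ≥ 5); a special case of `SparseOdd`. [difficulty:
provable-now] [doi:10.46298/theoretics.23.5]

TWO-LAYER PLAN. Foreseen split of `DenseResidualOdd` once `ShotsOdd` closes: `DenseResidualOdd ⇐
FeatureHard → VisitParityElim → DenseResidualOdd` is NOT yet a proved
glue; the planner memo (HOME/qa-qnc0-p2/ROUND-14.md §3) records the K-feature fibre form (strategies
y_g(u) = tab_g(f_1(u),…,f_K(u)) reduce, fibrewise, to
residue elimination when no deep-interior cut fires and to VISIT-PARITY ELIMINATION when one does)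
as the candidate layer-2 children.

KILL CRITERIA. A refutation of `ShotsOdd` at any fixed B ≥ 3 (a B-shot polylog-degree 𝔽₅ strategy
winning with probability → 1) closes the route outright (it would
refute `WalkHardF 5`, hence the thesis; the leaf itself would survive only via another relation
family). A refutation of `DenseResidualOdd` by an explicit
dense strategy likewise kills the thesis `WalkHardF p` and forces the pivot «other relation family»
(p1's D-walk instruments at p = 3 show the shape).
A proof that `DenseResidualOdd` implies a printed-open CDH-type bound does not kill the route but
re-labels it FRONTIER (banked rungs, no summit distance).

NOT DECOMPOSED YET. `DenseResidualOdd` is deliberately one node: every decomposition tried in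
ROUND-12/13 (labels-given fibre, charge rotation, trailing block, cluster-trit
randomisation, ChargeRecursion induction) bottoms out in an XOR-of-≳n^{1/3}-hidden-tests correlation
bound; the K-feature / visit-parity split is recorded
in the memo and will be filed only with a proved glue. Constants (η₀(p), c₀(p) of `elimLevelSqrtF`,
the surgery fraction) are left to the provers.

CHEAPEST FALSIFIER. Hill-climb / exhaustive search for p = 5, small n (10–16), degree ≤ 2, over
strategies with ≤ 3 shots per input, maximising the win fraction of
`ringWinU` (the cell's p = 5 hill-climb for unrestricted degree-2 strategies peaked at 0.77@n=10 →
0.70@n=14, consistent with → 2/3; ROUND-13 §3♯(3));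
a B = 3 family whose win rate INCREASES with n would retire `ShotsOdd` before any Lean is written.
In Lean: `twoShotHardF` (B = 2) and `walkEasyThree`
(p = 3 is genuinely excluded) are the calibration points already in the tree.

NUMBERS. θ(ShotsOdd) = 1 − η₀(p)/2 with η₀(p) = the constant of `elimLevelSqrtF p` (tree: εA =
min(e^{−6400p²λ}, 1/1000), λ = 1/4 bookkeeping in
`lowDegAvoidMod3SparseF`); budget B·(log₂ n)^C ≤ c₀(p)·√L with L ≥ η₀ n/(16B); the 2/3 baseline is
attained by the one-shot strategy (tree `chargeTriple`).

DEFINITION REQUESTS. Operator: mint the rung leaf F-Q2-odd = `∀ (p : ℕ) [Fact p.Prime], 5 ≤ p →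
Summit.QuantumAdvantage.AdviceFreeQNC0.AdviceFreeQNC0Sep p` as an
alt-closer of QuantumAdvantage/QuantumAdvantage (class rung), after a prover lands the one-line def;
then `route edit --closes-target`.

Novelty: Searches (2026-08-27): lit search --hybrid "relation problem shallow quantum circuits AC0[p] lower
bound modular gates advice" (6 book hits: Jukna 2012,
Arora–Barak — background only); earlier seat searches (ROUND-13): lit search "constant degree
hypothesis" → [corpus: BST90 p.10 CONJECTURE], Kawałek–Weiß
arXiv:2311.17440 pp.1–4, Grolmusz DMTCS 2001 §4.1; lit galaxy search "parity halving|hidden linear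
function" --star all (BGK18, WKST19, GS20, CCK22, GK24 —
all with advice or p = 2); no hits for "shots per input|cut-free interval" in corpus(fts+vec) and
galaxy.
Nearest prior art found: arXiv:1906.08890 (WKST19: QNC⁰ vs AC⁰[p] WITH advice / rpoly, §1.3 leaves
the advice-free case open); arXiv:2408.16406 (GK24 §1.3,
same question for all p); doi:10.46298/theoretics.23.5 (Srinivasan 2023, robust Hegedűs lemma — the
elimination input).
Delta: advice-free and odd p: the advice is replaced by the cycle's own mod-3 walk, and the new
per-input-sparsity fibre (random cut-free surgery +
truncated inclusion–exclusion + two-speed naming) proves every rung short of the dense regime, which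
is isolated as one typed residual.
Claimed grade: new-combination  [refs: 10.46298/theoretics.23.5, 2311.17440, 1906.08890, 2408.16406, doi:10.46298/theoretics.23.5]

Barriers (technique_class: polynomial-method, razborov-smolensky, fibre-elimination): - technique_class: polynomial-method, razborov-smolensky, fibre-elimination
- Literature.Barriers.QuantumAdvantage.NaturalProofs: inside the class (Smolensky-type arguments are
natural) but void here: FAC⁰[p] supports no pseudorandom functions, so the barrier's hypothesis does
not quantify over this target.
- Literature.Barriers.QuantumAdvantage.Relativization: outside — a concrete circuit-class statement
about explicit polynomials, no oracle in sight.
- Literature.Barriers.QuantumAdvantage.Algebrization: outside for the same reason (non-relativizing,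
explicit low-degree combinatorics).
- Literature.Barriers.QuantumAdvantage.TotalFunctionSpeedupLimit: outside — that barrier bounds
quantum QUERY speed-ups for TOTAL DECISION functions f : {0,1}^N → {0,1}; the target here is a
RELATION (search) problem for constant-depth CIRCUITS (cycle hidden-linear-function game, many valid
outputs per input), which the 2026-08-16 audit lists among the escapes (relations / search problems,
evasion 2), and the «polynomial method» used is Razborov–Smolensky approximation of FAC⁰[p] circuits
by low-degree 𝔽_p-polynomials, not approximate degree of a total f.
- Literature.Barriers.QuantumAdvantage.QuantumNaturalProofs: void here for the same reason as
NaturalProofs — the lower bound is against FAC⁰[p] (no pseudorandom function candidates live in the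
class), not against P/poly.
- Uncatalogued (recorded in ROUND-13 §3♯ with sources): the Constant Degree Hypothesis class (BST90;
arXiv:2311.17440) — `

History (route lifecycle, newest last):
- 2026-08-27T21:22:25Z · closes_target -> closes rung F-Q1-odd of QuantumAdvantage: Summit.QuantumAdvantage.AdviceFreeQNC0.AdviceFreeQNC0Odd (D-0061; not the summit Statement) (planner-qa-qnc0-p2-g15-0)
- 2026-08-27T21:55:11Z · closes_target -> closes rung F-Q1-odd of QuantumAdvantage: Summit.QuantumAdvantage.AdviceFreeQNC0.AdviceFreeQNC0Odd (D-0061; not the summit Statement) (planner-qa-qnc0-p2-g15-0)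
- 2026-08-27T22:00:52Z · closes_target -> closes rung F-Q1-odd of QuantumAdvantage: Summit.QuantumAdvantage.AdviceFreeQNC0.AdviceFreeQNC0Odd (D-0061; not the summit Statement) (planner-qa-qnc0-p2-g15-0)
- 2026-08-27T22:01:53Z · rev 5: restated ShotsSqrtOdd (stmt-QuantumAdvantage-22958) — exponent alignment (NOT a refutation repair): the split children were typed with budget exponent (2*C+2) while the tree's R6 theorem AdviceFreeQNC0.walkHardFSho (planner-qa-qnc0-p2-g15-0)
- 2026-08-27T22:03:02Z · rev 6: restated DenseResidualSqrtOdd (stmt-QuantumAdvantage-22957) — exponent alignment, second half (NOT a refutation repair): restate the √n-dense residual 1:1 with the negated threshold exponent (2*C+3), the exact complement o (planner-qa-qnc0-p2-g15-0)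

sub-problem: QuantumAdvantage · status: draft · opened planner-qa-qnc0-p2-g15-0 2026-08-27T21:13:28Z · rev 8 · ledger route-QuantumAdvantage-OddPrimeWalk
GENERATED by the gate from the ledger (D-0016/17). Provers cite these decls: `theorem foo : Summit.QuantumAdvantage.QuantumAdvantage.Theses.OddPrimeWalk.<Decl> := …` in Summits/QuantumAdvantage/QuantumAdvantage/Theorems/<Name>.lean.
-/

namespace Summit.QuantumAdvantage.QuantumAdvantage.Theses.OddPrimeWalk

open scoped BigOperators Topology Manifold Classical MeasureTheory ProbabilityTheory Matrix InnerProductSpace ComplexConjugate ContinuousMap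
open Filter Set Function TopologicalSpace MeasureTheory

attribute [summit_statement] _root_.QuantumAdvantage
attribute [summit_statement] _root_.Summit.QuantumAdvantage.AdviceFreeQNC0.AdviceFreeQNC0Odd

open Literature.QuantumAdvantage

/-- item stmt-QuantumAdvantage-22727 · crux · rank 2 · SPLIT (gen 1) into DenseResidualSqrtOdd, ShotsSqrtOdd + glue DenseResidualOddGlue · direct attempts still welcome (low priority) · by planner
why it might fail: a dense player XORs ≳ n^{1/3} hidden-label shots; any test-oblivious proof yields a CDH-type MOD₂∘MOD_p∘AND bound (BST90, open for fan-in ≥ 2) — true-but-out-of-reach, or false via a walk-specific dense trick.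
sources: arXiv:2311.17440, arXiv:1906.08890, arXiv:2408.16406, doi:10.46298/theoretics.23.5
retired/moot children: DenseResidualSqrtOdd [replaced: ∀ (p : ℕ) [Fact p.Prime], 5 ≤ p → ∃ θ : ℝ, θ < 1 ∧ ∀ C : ℕ, ∃ n₀ : ℕ, ∀ n ≥ n₀, ]; ShotsSqrtOdd [replaced: ∀ (p : ℕ) [Fact p.Prime], 5 ≤ p → ∃ θ : ℝ, θ < 1 ∧ ∀ C : ℕ, ∃ n₀ : ℕ, ∀ n ≥ n₀, ]
[crux] For every prime p ≥ 5 there is θ < 1 such that for all C and all large n, every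
𝔽_p-degree-(log₂ n)^C strategy whose maximal number of shots per input b satisfies b³(log₂ n)^{2C+2}
> n wins `ringWinU c y` on at most θ·2ⁿ inputs (the dense-per-input residual of `WalkHardF p`).
[difficulty: open-problem] -/
@[route_item "route-QuantumAdvantage-OddPrimeWalk", crux]
def DenseResidualOdd : Prop :=
  ∀ (p : ℕ) [Fact p.Prime], 5 ≤ p → ∃ θ : ℝ, θ < 1 ∧ ∀ C : ℕ, ∃ n₀ : ℕ, ∀ n ≥ n₀, ∀ c : ℕ, ∀ y : Fin (n + 1) → (Fin n → Bool) → Bool, (∀ g, Summit.QuantumAdvantage.AdviceFreeQNC0.HasDegF p (y g) ((Nat.log 2 n) ^ C)) → ¬ ((Finset.univ.sup fun u : Fin n → Bool => (Finset.univ.filter fun g : Fin (n + 1) => y g u = true).card) ^ 3 * (Nat.log 2 n) ^ (2 * C + 2) ≤ n) → ((Finset.univ.filter fun u : Fin n → Bool => Summit.QuantumAdvantage.AdviceFreeQNC0.ringWinU c y u = true).card : ℝ) ≤ θ * (2 : ℝ) ^ n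

-- parent: DenseResidualOdd · child (gen 1)
/--     item stmt-QuantumAdvantage-23029 · crux · rank 201 · open
    parent: DenseResidualOdd · by planner
    why it might fail: θ<1 is uniform over ALL strategies of degree (log₂ n)^C; a strategy of ≈√n/polylog adaptive shots imitating the p=3 three-test player on inputs of weight n/2+O(√n) could drive θ(p)→1. Only the p=2 case (WalkHard, ParityHalfGap) is proved; no published bound for p ≥ 5.
    sources: arXiv:1906.08890, Smolensky1987, Summit.QuantumAdvantage.AdviceFreeQNC0.WalkHardFShotsSqrt
[crux, rank 2, RESEARCH — not for provers] The √n-DENSE RESIDUAL: polylog-𝔽_p-degree strategies (p ≥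
5) whose maximal shot count b per input satisfies ¬(b²·(log₂ n)^{2C+2} ≤ n) win α's u-walk game on ≤
θ·2ⁿ inputs. Complement of rung R6 `ShotsSqrtOdd`; the per-input-sparsity method is VOID here (fibre
length L ≲ n/b ≤ √n·polylog tolerates degree ≤ c₀√L while one promise-parity already costs ≳ √b:
ROUND-14 (p2) §3 CEILING). New idea needed: two-moduli (MOD₃∘MOD₂-type) dense strategies at polylog
degree are outside every printed correlation bound (CDH-class wall). -/
@[route_item "route-QuantumAdvantage-OddPrimeWalk"]
def DenseResidualSqrtOdd : Prop :=
  ∀ (p : ℕ) [Fact p.Prime], 5 ≤ p → ∃ θ : ℝ, θ < 1 ∧ ∀ C : ℕ, ∃ n₀ : ℕ, ∀ n ≥ n₀, ∀ c : ℕ, ∀ y : Fin (n + 1) → (Fin n → Bool) → Bool, (∀ g, AdviceFreeQNC0.HasDegF p (y g) ((Nat.log 2 n) ^ C)) → ¬ ((Finset.univ.sup fun u : Fin n → Bool => (Finset.univ.filter fun g : Fin (n + 1) => y g u = true).card) ^ 2 * (Nat.log 2 n) ^ (2 * C + 3) ≤ n) → ((Finset.univ.filter fun u : Fin n → Bool =>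 AdviceFreeQNC0.ringWinU c y u = true).card : ℝ) ≤ θ * (2 : ℝ) ^ n

-- parent: DenseResidualOdd · child (gen 1)
/--     item stmt-QuantumAdvantage-23022 · crux · rank 202 · closed · proved by Summit.QuantumAdvantage.QuantumAdvantage.Theorems.oddPrimeWalk_shotsSqrtOdd (prover)
    parent: DenseResidualOdd · by planner
    why it might fail: Memo-level only until 21:53Z; now LANDED as the tree theorem walkHardFShotsSqrt (p) (hp3 : p ≠ 3) (qn-prover-3 g8, p575132) with budget exponent 2C+3 — the item closes by fun p _ hp => walkHardFShotsSqrt p (by omega).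
    sources: Summit.QuantumAdvantage.AdviceFreeQNC0.walkHardFShotsSqrt, arXiv:1906.08890, SrinivasanTripathiVenkitesh2021
[crux, rank 4, rung R6 — PROVER-READY] `∀ p ≥ 5, WalkHardFShotsSqrt p`: strategies of 𝔽_p-degree
(log₂ n)^C firing at most B cuts on every input, with B²·(log₂ n)^{2C+2} ≤ n (√n shots, up from R5's
∛n), win α's u-walk game on ≤ θ·2ⁿ inputs, one θ < 1 for all C. Proof plan (ROUND-14 (p2) §3,
memo-level complete): R5's interval surgery (tree `exists_quiet_interval`, `surgery`) with L ≈
η₀n/(2B); on each fibre the named losing residue factors through the six speed×label parities of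
fired cuts (g8, S); each promise-parity has ε-error probabilistic 𝔽_p-degree ≤ D·stvDegree p (B+1) ε
= O_p(D√B) (qn-lit `ufam_promiseParity_comp`, p571915, from STV21 Thm 18
`STV2021_thresholdProbDegree_holds`) and level sets of the residue degree ≤ 6× that
(`UFam.boolPost`, p572878); fix a realisation per fibre with error set X, |X| ≤ ε·2^L; conclude with
g10's robust elimination `elimLevelSqrtF_robust` (p571672) — budget 6·D·K_p√B ≤ c₀√L ⟺ B²D² ≲ n,
(log₂ n)² slack absorbs constants. Provers: g8 (assembly + six-parity factorisation), g10 (UFam →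
robust-elimination bridge). -/
@[route_item "route-QuantumAdvantage-OddPrimeWalk"]
def ShotsSqrtOdd : Prop :=
  ∀ (p : ℕ) [Fact p.Prime], 5 ≤ p → ∃ θ : ℝ, θ < 1 ∧ ∀ C : ℕ, ∃ n₀ : ℕ, ∀ n ≥ n₀, ∀ c B : ℕ, ∀ y : Fin (n + 1) → (Fin n → Bool) → Bool, (∀ g, AdviceFreeQNC0.HasDegF p (y g) ((Nat.log 2 n) ^ C)) → (∀ u, (Finset.univ.filter fun g : Fin (n + 1) => y g u = true).card ≤ B) → B ^ 2 * (Nat.log 2 n) ^ (2 * C + 3) ≤ n → ((Finset.univ.filter fun u : Fin n → Bool => AdviceFreeQNC0.ringWinU c y u = true).card : ℝ) ≤ θ * (2 : ℝ) ^ n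

-- `ShotsSqrtOdd` holds: proved by `Summit.QuantumAdvantage.QuantumAdvantage.Theorems.oddPrimeWalk_shotsSqrtOdd` (its module imports this route file, so no `_holds` link can be stated here).

-- parent: DenseResidualOdd · glue (gen 1)
/--     item stmt-QuantumAdvantage-22959 · support · rank 203 · closed · proved by Summit.QuantumAdvantage.QuantumAdvantage.Theorems.denseResidualOddGlue_proof (prover)
    parent: DenseResidualOdd · GLUE: children ⟹ parent · by planner
DICHOTOMY GLUE at the √n threshold (S, provable now): ShotsSqrtOdd → DenseResidualSqrtOdd →
DenseResidualOdd — given y with b³·(log₂ n)^{2C+2} > n (b = sup shots), case b²·(log₂ n)^{2C+2} ≤ n: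
apply ShotsSqrtOdd with B := b (promise ∀ u, shots ≤ b from Finset.le_sup); else
DenseResidualSqrtOdd; θ := max θ₁ θ₂, n₀ := max. Certified in the planner's Sketch15p2.lean
(HOME/qa-qnc0-p2/line15/) by an explicit term. -/
@[route_item "route-QuantumAdvantage-OddPrimeWalk"]
def DenseResidualOddGlue : Prop :=
  DenseResidualSqrtOdd → ShotsSqrtOdd → DenseResidualOdd

-- `DenseResidualOddGlue` holds: proved by `Summit.QuantumAdvantage.QuantumAdvantage.Theorems.denseResidualOddGlue_proof` (its module imports this route file, so no `_holds` link can be stated here).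

/-- item stmt-QuantumAdvantage-23109 · crux · rank 2 · open · by planner
[crux, rank 2, RESEARCH — not for provers] The √n-dense, EVERY-PAIR-FAR-READ residual:
polylog-𝔽_p-degree strategies (p ≥ 5) with maximal shot count b, ¬(b²·(log₂ n)^{2C+3} ≤ n), in which
for every adjacent pair (a, a+1), every w ≤ (log₂ n)^C and every finset S of ≤ (log₂ n)^C cuts some
cut outside S and outside [a−w, a+2+w] depends on the pair, win on ≤ θ·2ⁿ inputs. Complement of R6 ∪
R8. Members: counter strategies (cuts reading |u_{<g−w}| mod p, degree p−1 — removable by the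
block-triple variant R7⁺, ROUND-15 §3.5), permuted-local strategies y_g = u_{g+n/2}. The genuine
core: many readers at HIDDEN walk states — their flip parities per state class are visit parities
with hidden labels (VPE, ROUND-14 §4 / ROUND-15 §4); naming is impossible there, equidistribution is
what must be proved. WHY IT MIGHT FAIL: θ<1 must hold uniformly; a strategy whose cuts read distant
bits through MOD_p counters plus √n adaptive shots might correlate its register with |u| mod 3 — no
correlation bound for parities of many low-degree 𝔽_p functions at hidden labels is in print (VPE
open). SOURCES: arXiv:1906.08890, Smolensky1987, BarringtonStraubingTherien1990 -/
@[route_item "route-QuantumAdvantage-OddPrimeWalk"]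
def ManyReadersSqrtOdd : Prop :=
  ∀ (p : ℕ) [Fact p.Prime], 5 ≤ p → ∃ θ : ℝ, θ < 1 ∧ ∀ C : ℕ, ∃ n₀ : ℕ, ∀ n ≥ n₀, ∀ c : ℕ, ∀ y : Fin (n + 1) → (Fin n → Bool) → Bool, (∀ g, AdviceFreeQNC0.HasDegF p (y g) ((Nat.log 2 n) ^ C)) → ¬ ((Finset.univ.sup fun u : Fin n → Bool => (Finset.univ.filter fun g : Fin (n + 1) => y g u = true).card) ^ 2 * (Nat.log 2 n) ^ (2 * C + 3) ≤ n) → (∀ w a : ℕ, ∀ S : Finset (Fin (n + 1)), w ≤ (Nat.log 2 n) ^ C → a + 2 ≤ n → S.card ≤ (Nat.log 2 n) ^ C → ∃ g : Fin (n + 1), g ∉ S ∧ (g.val + w < a ∨ a + 2 + w < g.val) ∧ ∃ u v : Fin n → Bool, (∀ i : Fin n, i.val ≠ a → i.val ≠ a + 1 → u i = v i) ∧ y g u ≠ y g v) → ((Finset.univ.filter fun u : Fin n → Bool => AdviceFreeQNC0.ringWinU c y u = true).card : ℝ) ≤ θ * (2 : ℝ) ^ n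

/-- item stmt-QuantumAdvantage-22728 · crux · rank 4 · closed · proved by Summit.QuantumAdvantage.QuantumAdvantage.Theorems.oddPrimeWalk_shotsOdd (prover) · by planner
why it might fail: the surgery (zero the shots inside one of ⌊n/L⌋ intervals, cost ≤ B·L/n) and the truncated inclusion–exclusion bound 1_{F(z)=Y₀} ∈ lowDeg(B·D) must hold in ONE fibre; a slip in the two-speed exponent at the interval ends forces a restatement (not a collapse).
sources: doi:10.46298/theoretics.23.5, arXiv:1704.00690
[crux] For every prime p ≥ 5 there is θ < 1 such that for all C and all large n, every
𝔽_p-degree-(log₂ n)^C strategy firing at most B cuts on every input, with B³(log₂ n)^{2C+2} ≤ n,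
wins `ringWinU c y` on at most θ·2ⁿ inputs (per-input-sparse rung; subsumes the landed
`TwoShotHardF` (B = 2) and `WalkHardFSparse`). [difficulty: M] -/
@[route_item "route-QuantumAdvantage-OddPrimeWalk", crux]
def ShotsOdd : Prop :=
  ∀ (p : ℕ) [Fact p.Prime], 5 ≤ p → ∃ θ : ℝ, θ < 1 ∧ ∀ C : ℕ, ∃ n₀ : ℕ, ∀ n ≥ n₀, ∀ c B : ℕ, ∀ y : Fin (n + 1) → (Fin n → Bool) → Bool, (∀ g, Summit.QuantumAdvantage.AdviceFreeQNC0.HasDegF p (y g) ((Nat.log 2 n) ^ C)) → (∀ u, (Finset.univ.filter fun g : Fin (n + 1) => y g u = true).card ≤ B) → B ^ 3 * (Nat.log 2 n) ^ (2 * C + 2) ≤ n → ((Finset.univ.filter fun u : Fin n → Bool => Summit.QuantumAdvantage.AdviceFreeQNC0.ringWinU c y u = true).card : ℝ) ≤ θ * (2 : ℝ) ^ n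

-- `ShotsOdd` holds: proved by `Summit.QuantumAdvantage.QuantumAdvantage.Theorems.oddPrimeWalk_shotsOdd` (its module imports this route file, so no `_holds` link can be stated here).

/-- item stmt-QuantumAdvantage-23108 · support · rank 4 · closed · proved by Summit.QuantumAdvantage.QuantumAdvantage.Theorems.DenseResidualSqrtOdd.stub_fewReadersOdd (prover) · by planner
[crux, rank 4, rung R8 — PROVABLE NOW, size M] `∀ p ≥ 5, WalkHardFFewReaders p` (body verbatim,
HOME/qa-qnc0-p2/line15/Sketch15R7.lean): if SOME adjacent bit pair (a, a+1) is read by at most (log₂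
n)^C cuts outside the window [a−w, a+2+w] (w ≤ (log₂ n)^C; exceptional finset S), a
polylog-𝔽_p-degree strategy wins the u-walk game on ≤ θ·2ⁿ inputs, θ = 1 − η₀(p)/4. Proof (ROUND-15
(p2) §3.1–§3.6): end-game register identity WIN ⟺ R ≠ 0 ∧ j(R) ≠ x in V₄ = (ℤ/2)³/⟨111⟩; pair
decomposition R(z_t) = α + P_t + rot^h(D_t) + rot^{h+t}(β + Q_t) in the fibre over the largest
reader-free block B (|B| ≥ n/(3(log₂ n)^C)); the kernel-checked finite lemma
`Endgame.finiteEndgameGeneral` (native_decide) names a bad residue h_bad(P,D,Q,K) whose level sets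
have degree ≤ 7(log₂ n)^{2C}; `ElimHardF p` (tree `elimHardF p hp3`) on B gives ≥ η₀·2^{|B|} bad
fibres, each losing one of its 3 representative inputs. Contains all w-local strategies (R7 = S = ∅,
`walkHardFPairLocal_of_fewReaders`). First rung with Θ(n) shots. WHY IT MIGHT FAIL: Memo-level
proof; the fibre bookkeeping (every z-independent cut is absorbed by the free α/β, every reader is
anchored or at a fixed offset from h or h+t in the chosen bloc -/
@[route_item "route-QuantumAdvantage-OddPrimeWalk"]
def FewReadersOdd : Prop :=
  ∀ (p : ℕ) [Fact p.Prime], 5 ≤ p → ∃ θ : ℝ, θ < 1 ∧ ∀ C : ℕ, ∃ n₀ : ℕ, ∀ n ≥ n₀, ∀ c w a : ℕ, w ≤ (Nat.log 2 n) ^ C → a + 2 ≤ n → ∀ y : Fin (n + 1) → (Fin n → Bool) → Bool, (∀ g, Summit.QuantumAdvantage.AdviceFreeQNC0.HasDegF p (y g) ((Nat.log 2 n) ^ C)) → ∀ S : Finset (Fin (n + 1)), S.card ≤ (Nat.log 2 n) ^ C → (∀ g : Fin (n + 1), g ∉ S → (g.val + w < a ∨ a + 2 + w < g.val) → ∀ u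 v : Fin n → Bool, (∀ i : Fin n, i.val ≠ a → i.val ≠ a + 1 → u i = v i) → y g u = y g v) → ((Finset.univ.filter fun u : Fin n → Bool => Summit.QuantumAdvantage.AdviceFreeQNC0.ringWinU c y u = true).card : ℝ) ≤ θ * (2 : ℝ) ^ n

-- `FewReadersOdd` holds: proved by `Summit.QuantumAdvantage.QuantumAdvantage.Theorems.DenseResidualSqrtOdd.stub_fewReadersOdd` (its module imports this route file, so no `_holds` link can be stated here).

/-- item stmt-QuantumAdvantage-23167 · support · rank 5 · closed · proved by Summit.QuantumAdvantage.QuantumAdvantage.Theorems.oddPrimeWalk_linTestsOdd (prover) · by planner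
[crux→provable rung R11, aside-class] ∀ p ≥ 5, WalkHardFLinTests p: a strategy reading u only
through K ≤ (log₂ n)^C global LINEAR tests mod p (dense coefficients) with arbitrary dense tables
loses ≥ η/2. Proof (ROUND-15 (p2) §3.11): e_p-twisted transfer operators of the walk (‖½(S₁+ζS₂)‖ =
cos(π/3p) < 1, p ≠ 3) + character expansion of the cell (p^K terms) +
Chattopadhyay–Wigderson/–Lovett regularisation + JUNTA COROLLARY of R8 (FewReadersOdd, 23108 /
stub_fewReadersOdd on 23029). WHY IT MIGHT FAIL: the regularisation bookkeeping (junta set J vs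
w-regular remainder) and the dependence of n₀ on K·w through R8's budget exponent; false at p = 3 by
design (ρ₃ = 1). SOURCES: doi:10.1109/ccc.2011.25 (Chattopadhyay–Lovett 2011, Thm 1), Smolensky1987,
Summit.QuantumAdvantage.AdviceFreeQNC0.elimHardF -/
@[route_item "route-QuantumAdvantage-OddPrimeWalk"]
def LinTestsOdd : Prop :=
  ∀ (p : ℕ) [Fact p.Prime], 5 ≤ p → ∃ θ : ℝ, θ < 1 ∧ ∀ C : ℕ, ∃ n₀ : ℕ, ∀ n ≥ n₀, ∀ c K : ℕ, K ≤ (Nat.log 2 n) ^ C → ∀ lam : Fin K → Fin n → ZMod p, ∀ A : Fin K → Finset (ZMod p), ∀ tab : Fin (n + 1) → (Fin K → Bool) → Bool, ((Finset.univ.filter fun u : Fin n → Bool => Summit.QuantumAdvantage.AdviceFreeQNC0.ringWinU c (fun g v => tab g fun j => decide ((∑ i, if v i then lam j i else 0) ∈ A j)) u = true).card : ℝ) ≤ θ * (2 : ℝ) ^ n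

/-- `LinTestsOdd` holds: proved by `Summit.QuantumAdvantage.QuantumAdvantage.Theorems.oddPrimeWalk_linTestsOdd`. -/
theorem LinTestsOdd_holds : LinTestsOdd := _root_.Summit.QuantumAdvantage.QuantumAdvantage.Theorems.oddPrimeWalk_linTestsOdd

/-- item stmt-QuantumAdvantage-22578 · support · rank 9 · closed · proved by Summit.QuantumAdvantage.AdviceFreeQNC0.Coset21.noPerfectLinSelOdd (prover) · by planner
[support] R5₀ (ROUND-21 §2 / ROUND-23 §1): for every prime p ≥ 5 no linear-test (LinSel) strategy
wins the u-walk game on every input (n ≥ n₀(p); n₀(5) ≤ 62, kit K-26 shows perfect strategies for n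
≤ 8). PROVED: HOME/qa-qnc0-p2/line23/WalkNoPerfectLinSel.lean (farm rc 0, 0 sorry, 480 l., sha16
1a14df067c12abf7), closing decl Summit.QuantumAdvantage.AdviceFreeQNC0.Coset21.noPerfectLinSelOdd —
method: char-2 linearisation of the parity gate in F_2(mu_3p) + product killing functional + double
counting. BC5/T3 witness #3 for OddPrimeWalk: a theorem about ARBITRARY (dense) single-residue
linear tests, i.e. inside the (W2)-residual class of cruxes 23109/23029; it does NOT move them (no
θ<1). Why it might fail: it cannot — proof attached; land verbatim as
Theorems/WalkNoPerfectLinSel.lean --supports this item. Sources: Krause–Pudlák TCS 174 (1997)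
doi:10.1016/S0304-3975(96)00019-9 Thm 5 (nearest, different mechanism); Jukna 2012 §12.6. -/
@[route_item "route-QuantumAdvantage-OddPrimeWalk"]
def NoPerfectLinSelOdd : Prop :=
  ∀ (p : ℕ) [Fact p.Prime], 5 ≤ p → Summit.QuantumAdvantage.AdviceFreeQNC0.Coset21.NoPerfectLinSel p

/-- `NoPerfectLinSelOdd` holds: proved by `Summit.QuantumAdvantage.AdviceFreeQNC0.Coset21.noPerfectLinSelOdd`. -/
theorem NoPerfectLinSelOdd_holds : NoPerfectLinSelOdd := _root_.Summit.QuantumAdvantage.AdviceFreeQNC0.Coset21.noPerfectLinSelOdd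

/-- item stmt-QuantumAdvantage-22607 · support · rank 9 · closed · proved by Summit.QuantumAdvantage.AdviceFreeQNC0.Coset21.linSelSubcubeLossOdd (prover) · by planner
[support] R5₀⁺ = quantitative NoPerfectLinSel (ROUND-23 §1, Theorem B): for every prime p ≥ 5, m ≤ n
and (n+1)·2p·(2p−1)^m < (2p)^m (true for m ≥ 2p·ln(2p(n+1)), i.e. m = O(p log(pn))), every
linear-test (LinSel) strategy LOSES the u-walk game on ≥ 2^{n−m} inputs — inverse-polynomial loss
density (2p(n+1))^{−O(p)} for ARBITRARY (dense) single-residue linear tests, the residual class of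
cruxes 23109/23029. PROVED: HOME/qa-qnc0-p2/line23/WalkNoPerfectLinSel.lean (farm rc 0, 0 sorry),
closing decl Summit.QuantumAdvantage.AdviceFreeQNC0.Coset21.linSelSubcubeLossOdd (type = signature
verbatim). Method: char-2 linearisation of the parity gate + killing functional on every subcube
with the last n−m coordinates frozen. NOT θ<1 (does not close R5/WalkHardFLinSel nor move
23109/23029): it is the CEILING of the method (bc9: capped-at-inverse-polynomial-loss). Why it might
fail: cannot — proof attached. Sources: Krause–Pudlák doi:10.1016/S0304-3975(96)00019-9 Thm 5
(nearest, different mechanism). -/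
@[route_item "route-QuantumAdvantage-OddPrimeWalk"]
def LinSelSubcubeLossOdd : Prop :=
  ∀ (p : ℕ) [Fact p.Prime], 5 ≤ p → ∀ n m : ℕ, m ≤ n → (n + 1) * (2 * p) * (2 * p - 1) ^ m < (2 * p) ^ m → ∀ c : ℕ, ∀ y : Fin (n + 1) → (Fin n → Bool) → Bool, Summit.QuantumAdvantage.AdviceFreeQNC0.LinSel p y → 2 ^ (n - m) ≤ (Finset.univ.filter fun u : Fin n → Bool => Summit.QuantumAdvantage.AdviceFreeQNC0.ringWinU c y u = false).card

/-- `LinSelSubcubeLossOdd` holds: proved by `Summit.QuantumAdvantage.AdviceFreeQNC0.Coset21.linSelSubcubeLossOdd`. -/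
theorem LinSelSubcubeLossOdd_holds : LinSelSubcubeLossOdd := _root_.Summit.QuantumAdvantage.AdviceFreeQNC0.Coset21.linSelSubcubeLossOdd

/-- item stmt-QuantumAdvantage-22693 · support · rank 9 · closed · proved by Summit.QuantumAdvantage.AdviceFreeQNC0.Coset21.noPerfectFinState2Odd (prover) · by planner
[support] (H) for EVERY prime p ≥ 5: for large n no finite-state 2-step (FinState2: tables of
(wtPrefix mod p, wt mod p)) strategy wins the u-walk game on every input. Previously p = 5 only
(noPerfectFinState2_12 sharp, certified computation; and via rung (G)). PROVED off-tree by the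
planner (qa-qnc0-p2 g23, ROUND-23 §6): corollary of Theorem A-prime (k-form strategies, k = 2) by
the char-2 killing method; closing decl
Summit.QuantumAdvantage.AdviceFreeQNC0.Coset21.noPerfectFinState2Odd in
HOME/qa-qnc0-p2/line23/WalkNoPerfectKForm.lean (after WalkNoPerfectLinSelCore, WalkNoPerfectLinSel,
WalkNoPerfectKFormCore; 4-file concatenation farm rc 0 / 0 sorry, axioms standard). Why it might
fail: it cannot (kernel-checked); source: this seat, KP97 doi:10.1016/S0304-3975(96)00019-9 (nearest
method). -/
@[route_item "route-QuantumAdvantage-OddPrimeWalk"]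
def NoPerfectFinState2Odd : Prop :=
  ∀ (p : ℕ) [Fact p.Prime], 5 ≤ p → ∃ n₀, Summit.QuantumAdvantage.AdviceFreeQNC0.Coset21.NoPerfectFinState2 p n₀

/-- `NoPerfectFinState2Odd` holds: proved by `Summit.QuantumAdvantage.AdviceFreeQNC0.Coset21.noPerfectFinState2Odd`. -/
theorem NoPerfectFinState2Odd_holds : NoPerfectFinState2Odd := _root_.Summit.QuantumAdvantage.AdviceFreeQNC0.Coset21.noPerfectFinState2Odd

/-- item stmt-QuantumAdvantage-22697 · support · rank 9 · closed · proved by Summit.QuantumAdvantage.AdviceFreeQNC0.Coset21.noPerfectKFormOdd (prover) · by planner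
[support] Theorem A-prime (k-FORM strategies, ROUND-23 §6): for every prime p ≥ 5 and every k, for
large n (explicitly once (n+1)·2p^k·(2p−1)^n < (2p)^n, i.e. per-cut rank k up to ≈ n/((2p−1) ln p))
NO strategy in which each cut decides by an arbitrary table F g of k linear forms mod p of the input
wins the u-walk game on every input. k = 1 ⊇ LinSel and all single-form set-membership tests
(Theorem A = item NoPerfectLinSelOdd); k = 2 ⊇ FinState2 (item NoPerfectFinState2Odd); rank n
(arbitrary Boolean functions) plays perfectly, so a rank bound is necessary. PROVED off-tree by the
planner: char-2 linearisation + Fourier expansion on (ZMod p)^k + generic killing functional;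
closing decl Summit.QuantumAdvantage.AdviceFreeQNC0.Coset21.noPerfectKFormOdd in
HOME/qa-qnc0-p2/line23/WalkNoPerfectKForm.lean (4-file chain, concatenation farm rc 0 / 0 sorry,
axioms standard). Why it might fail: it cannot (kernel-checked). Source: this seat; nearest印 KP97
doi:10.1016/S0304-3975(96)00019-9. -/
@[route_item "route-QuantumAdvantage-OddPrimeWalk"]
def NoPerfectKFormOdd : Prop :=
  ∀ (p : ℕ) [Fact p.Prime], 5 ≤ p → ∀ k : ℕ, ∃ n₀ : ℕ, ∀ n ≥ n₀, ∀ c : ℕ, ∀ lam : Fin (n + 1) → Fin k → Fin n → ZMod p, ∀ F : Fin (n + 1) → (Fin k → ZMod p) → Bool, ∀ y : Fin (n + 1) → (Fin n → Bool) → Bool, (∀ g u, y g u = F g (fun j => Finset.univ.sum fun i => if u i = true then lam g j i else 0)) → ∃ u, Summit.QuantumAdvantage.AdviceFreeQNC0.ringWinU c y u = false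

/-- `NoPerfectKFormOdd` holds: proved by `Summit.QuantumAdvantage.AdviceFreeQNC0.Coset21.noPerfectKFormOdd`. -/
theorem NoPerfectKFormOdd_holds : NoPerfectKFormOdd := _root_.Summit.QuantumAdvantage.AdviceFreeQNC0.Coset21.noPerfectKFormOdd

/-- item stmt-QuantumAdvantage-22729 · support · rank 9 · closed · proved by Summit.QuantumAdvantage.QuantumAdvantage.Theorems.dichotomyGlue_proof (prover) · by planner
sources: arXiv:1704.00690
[support] `ShotsOdd → DenseResidualOdd → ∀ p ≥ 5, WalkHardF p`: θ := max θ₁ θ₂, n₀ := max, and for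
each strategy the case split on b³(log₂ n)^{2C+2} ≤ n with B := the maximal shot count
(`Finset.univ.sup`, `Finset.le_sup`). [difficulty: provable-now] -/
@[route_item "route-QuantumAdvantage-OddPrimeWalk", crux]
def DichotomyGlue : Prop :=
  ShotsOdd → DenseResidualOdd → ∀ (p : ℕ) [Fact p.Prime], 5 ≤ p → Summit.QuantumAdvantage.AdviceFreeQNC0.WalkHardF p

-- `DichotomyGlue` holds: proved by `Summit.QuantumAdvantage.QuantumAdvantage.Theorems.dichotomyGlue_proof` (its module imports this route file, so no `_holds` link can be stated here).

/-- item stmt-QuantumAdvantage-22730 · support · rank 9 · closed · proved by Summit.QuantumAdvantage.QuantumAdvantage.Theorems.bridgeOdd_proof (prover) · by planner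
sources: arXiv:1704.00690, arXiv:1906.08890
[support] the odd-prime ladder `WalkHardF p → AdviceFreeQNC0Sep p` for p ≥ 5 — PROVED in the tree
(`AdviceFreeQNC0.adviceFreeQNC0Sep_of_walkHardF`, OddPrimeLadder.lean p564188; one line closes the
item). [difficulty: provable-now] -/
@[route_item "route-QuantumAdvantage-OddPrimeWalk", crux]
def BridgeOdd : Prop :=
  ∀ (p : ℕ) [Fact p.Prime], 5 ≤ p → Summit.QuantumAdvantage.AdviceFreeQNC0.WalkHardF p → Summit.QuantumAdvantage.AdviceFreeQNC0.AdviceFreeQNC0Sep p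

-- `BridgeOdd` holds: proved by `Summit.QuantumAdvantage.QuantumAdvantage.Theorems.bridgeOdd_proof` (its module imports this route file, so no `_holds` link can be stated here).

/-- item stmt-QuantumAdvantage-22731 · aside · rank 9 · closed · proved by Summit.QuantumAdvantage.QuantumAdvantage.Theorems.oddPrimeWalk_gapOdd (prover) · by planner
sources: doi:10.46298/theoretics.23.5
[support] ASIDE (banked, rung R3, prover qn-prover-3 g8 kernel-done in dev): `WalkHardFGap p` for p
≥ 5 — a strategy with s potentially-active cuts and a cut-free bit interval of length L ≥ s²(log₂
n)^{2C+2} wins ≤ θ·2ⁿ; its fibre/naming lemmas are the engine of `ShotsOdd`. [difficulty: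
provable-now] -/
@[route_item "route-QuantumAdvantage-OddPrimeWalk"]
def GapOdd : Prop :=
  ∀ (p : ℕ) [Fact p.Prime], 5 ≤ p → Summit.QuantumAdvantage.AdviceFreeQNC0.WalkHardFGap p

-- `GapOdd` holds: proved by `Summit.QuantumAdvantage.QuantumAdvantage.Theorems.oddPrimeWalk_gapOdd` (its module imports this route file, so no `_holds` link can be stated here).

/-- item stmt-QuantumAdvantage-22732 · aside · rank 9 · closed · proved by Summit.QuantumAdvantage.QuantumAdvantage.Theorems.oddPrimeWalk_sparseOdd (prover) · by planner
sources: doi:10.46298/theoretics.23.5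
[support] ASIDE (banked, rung R4): `WalkHardFSparse p` for p ≥ 5 (s potentially-active cuts, s³(log₂
n)^{2C+3} ≤ n) — from `GapOdd` by the landed `sparseOfGap`; a special case of `ShotsOdd`.
[difficulty: provable-now] -/
@[route_item "route-QuantumAdvantage-OddPrimeWalk"]
def SparseOdd : Prop :=
  ∀ (p : ℕ) [Fact p.Prime], 5 ≤ p → Summit.QuantumAdvantage.AdviceFreeQNC0.WalkHardFSparse p

-- `SparseOdd` holds: proved by `Summit.QuantumAdvantage.QuantumAdvantage.Theorems.oddPrimeWalk_sparseOdd` (its module imports this route file, so no `_holds` link can be stated here).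

/-- item stmt-QuantumAdvantage-22733 · aside · rank 9 · closed · proved by Summit.QuantumAdvantage.QuantumAdvantage.Theorems.elimHardFOdd_proof (prover) · by planner
sources: doi:10.46298/theoretics.23.5, arXiv:2202.04982
[support] ASIDE (banked; LANDED p567244 `elimHardF (p) (hp3 : p ≠ 3)`, prover qn-prover g10 — closes
by one line): for p ≥ 5 no function with polylog-degree 𝔽_p level sets avoids |u| mod 3 (`ElimHardF
p`); the input of every fibre argument of this route. [difficulty: provable-now] -/
@[route_item "route-QuantumAdvantage-OddPrimeWalk"]
def ElimHardFOdd : Prop :=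
  ∀ (p : ℕ) [Fact p.Prime], 5 ≤ p → Summit.QuantumAdvantage.AdviceFreeQNC0.ElimHardF p

-- `ElimHardFOdd` holds: proved by `Summit.QuantumAdvantage.QuantumAdvantage.Theorems.elimHardFOdd_proof` (its module imports this route file, so no `_holds` link can be stated here).

/-- item stmt-QuantumAdvantage-22734 · aside · rank 9 · closed · proved by Summit.QuantumAdvantage.QuantumAdvantage.Theorems.anchoredOdd_proof (prover) · by planner
sources: doi:10.46298/theoretics.23.5
[support] ASIDE (banked, rung R2; defs LANDED p568202, proof p568925 in the gate, prover qn-prover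
g10): strategies whose potentially-active cuts lie in one window of length (log₂ n)^C win ≤ θ·2ⁿ
(`WalkHardFAnchored p`, p ≥ 5); a special case of `SparseOdd`. [difficulty: provable-now] -/
@[route_item "route-QuantumAdvantage-OddPrimeWalk"]
def AnchoredOdd : Prop :=
  ∀ (p : ℕ) [Fact p.Prime], 5 ≤ p → Summit.QuantumAdvantage.AdviceFreeQNC0.WalkHardFAnchored p

-- `AnchoredOdd` holds: proved by `Summit.QuantumAdvantage.QuantumAdvantage.Theorems.anchoredOdd_proof` (its module imports this route file, so no `_holds` link can be stated here).

/-- item stmt-QuantumAdvantage-23121 · support · rank 9 · closed · proved by Summit.QuantumAdvantage.QuantumAdvantage.Theorems.oddPrimeWalk_twoStepFreeRungFive (prover) · by planner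
sources: BarringtonStraubingTherien1990, Summits/QuantumAdvantage/QuantumAdvantage/Theorems/WalkFiniteStateRungTransfer.lean, Summits/QuantumAdvantage/QuantumAdvantage/Theorems/WalkNoPerfectLinSel.lean
[support] rung (G♯) of the R5 ladder (ROUND-24 §1bis/§1ter): for p = 5, every strategy whose tests
are TWO-STEP LINEAR FORMS WITH FREE SPLIT POINTS (test g fires iff α_g·N(s_g) + β_g·(W − N(s_g)) =
r_g in ZMod 5, s_g arbitrary — the first structured LinSel class outside every existing engine:
product functionals give only inverse-polynomial loss, the finite-state rung (G) = stmt-28072 needs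
split-at-cut) loses the u-walk game on ≥ (1−θ)·2ⁿ inputs for n ≥ n₀. Strictly between rung (G)
(proved) and R5 = WalkHardFLinSel 5 (open, (W2)-class). CHECKED SKELETON:
HOME/qa-qnc0-p2/line24/LocalEngine.lean (1013 l., sha16 7aa61edea42d6c70, farm rc 0 / 0 sorry):
`LocalEngine.twoStepFreeRungFive_of : FarLocal 5 → SparsePinned 5 → DensePinned 5 → <this
signature>` with all glue PROVED (double count over corner flips, second-involution count,
pigeonhole, flip invariance, two-case composition, pinned-part decomposition with Equidist); the
three open Props have elementary proof plans (odd-row lemma, line24/OddRow.lean kernel-checked;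
ROUND-24 §1ter REVISION (b)–(g)). Why it might fail: only if one of
FarLocal/SparsePinned/DensePinned is mis-typed (NearDense-type conditional-activation traps, D24-7) -/
@[route_item "route-QuantumAdvantage-OddPrimeWalk"]
def TwoStepFreeRungFive : Prop :=
  ∃ θ : ℝ, θ < 1 ∧ ∃ n₀ : ℕ, ∀ n ≥ n₀, ∀ c : ℕ, ∀ y : Fin (n + 1) → (Fin n → Bool) → Bool, (∀ g, ∃ s : ℕ, ∃ α β r : ZMod 5, ∀ u, y g u = decide ((Finset.univ.sum fun i : Fin n => if u i then (if i.val < s then α else β) else 0) = r)) → ((Finset.univ.filter fun u : Fin n → Bool => Summit.QuantumAdvantage.AdviceFreeQNC0.ringWinU c y u = true).card : ℝ) ≤ θ * (2 : ℝ) ^ n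

-- `TwoStepFreeRungFive` holds: proved by `Summit.QuantumAdvantage.QuantumAdvantage.Theorems.oddPrimeWalk_twoStepFreeRungFive` (its module imports this route file, so no `_holds` link can be stated here).

/-- item stmt-QuantumAdvantage-23286 · support · rank 9 · closed · proved by Summit.QuantumAdvantage.QuantumAdvantage.Theorems.oddPrimeWalk_threeStepFreeRungFive (prover) · by planner
[support, rung (G♯₂) = three-step forms, sequel of stmt-QuantumAdvantage-23121 (G♯); STRUCTURED side
of the (W2) dichotomy, cell qa-qnc0 p2 ROUND-24 §1bis ADDENDUM / ROUND-25 §4.4] For p = 5: some θ <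
1 and n₀ such that for all n ≥ n₀, every charge c and every strategy whose cut-g test is [ℓ_g·u =
r_g] with ℓ_g a THREE-STEP form (coefficient α on i < s, β on s ≤ i < t, γ on i ≥ t; split points
s,t and values free per cut — `KStepSel 5 2` of HOME/qa-qnc0-p2/line24/Sketch24.lean in explicit
parametrisation) wins the u-walk game ringWinU c on ≤ θ·2ⁿ inputs. Contains the two-step class of
23121 (t := n, γ := β; monotonicity `twoStepFreeRungFive_of_three` checked in
HOME/qa-qnc0-p2/line25/ThreeStepSig.lean, farm rc 0); up to n+1 DISTINCT structured forms, so NOT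
covered by LinFormsSqrtOdd (27290, K² ≤ κn forms) — the common-form family (G♭ₘ) IS covered by 27290
and is therefore not filed. Expected proof: the LocalEngine of 23121
(Theorems/WalkTwoStepLocalEngine*, SparsePinned/FarLocal/DensePinned) with TWO pins per far cut (two
mirror cuts in the four-point parity formula). WHY IT MIGHT FAIL: only engine bookkeeping — the
far/local regime split with two pinned positions per cut and the -/
@[route_item "route-QuantumAdvantage-OddPrimeWalk"]
def ThreeStepFreeRungFive : Prop :=
  ∃ θ : ℝ, θ < 1 ∧ ∃ n₀ : ℕ, ∀ n ≥ n₀, ∀ c : ℕ, ∀ y : Fin (n + 1) → (Fin n → Bool) → Bool, (∀ g, ∃ s t : ℕ, ∃ α β γ r : ZMod 5, ∀ u, y g u = decide ((Finset.univ.sum fun i : Fin n => if u i then (if i.val < s then α else if i.val < t then β else γ) else 0) = r)) → ((Finset.univ.filter fun u : Fin n → Bool => Summit.QuantumAdvantage.AdviceFreeQNC0.ringWinU c y u = true).card : ℝ) ≤ θ * (2 : ℝ) ^ n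

-- `ThreeStepFreeRungFive` holds: proved by `Summit.QuantumAdvantage.QuantumAdvantage.Theorems.oddPrimeWalk_threeStepFreeRungFive` (its module imports this route file, so no `_holds` link can be stated here).

/-- item stmt-QuantumAdvantage-23990 · support · rank 9 · closed · proved by Summit.QuantumAdvantage.QuantumAdvantage.Theorems.oddPrimeWalk_blindPairLaw (prover) · by planner
[support] BLIND PAIR LAW 8/9 (ROUND-28 THM 1, k = 2; planner qa-qnc0-p2 g28/g29): in the u-walk
game, if NO cut crosses position m (cuts g ≤ m read only bits < m, cuts g > m read only bits ≥ m;
fire-bit rules otherwise ARBITRARY, both halves may be dense) and both sides have ≥ m₀ bits, then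
#win ≤ (8/9 + 8·2^{-m₀})·2^n at every charge c; 8/9 is attained asymptotically. Engine: general-y
trace formula WIN = Tr(ζ^{c+W}·Σ_g y_g ζ^{g+W_g}) (as RungU.ringWinU_iff_ev, WalkThreeStepRegister),
register split R = R_A(u_A) + ζ^{W_A}·R_B(u_B), successive best responses (each half WLOG a
deterministic function of its own weight class), finite core: every pair of class profiles Z₃ → F₄
wins ≤ 8 of the 9 class cells (even-weight-code parity obstruction; kernel `decide`,
HOME/qa-qnc0-p2/line28/BlockProduct.lean `Block28.wonCells_le_eight`, farm rc 0), class counts ≤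
(2^m+2)/3. BC5-type witness for the dense cruxes 23029/23109 (product strategies with dense halves
lie outside every landed rung). Why it might fail: only a bookkeeping slip in the cut-position
convention (cut m assigned to the left half; its label m + W_m is left-measurable) or in the error
constant (8·2^{-m₀} is generous: (8/9)((1+2 -/
@[route_item "route-QuantumAdvantage-OddPrimeWalk"]
def BlindPairLaw : Prop :=
  ∀ m₀ n m c : ℕ, ∀ y : Fin (n + 1) → (Fin n → Bool) → Bool, m₀ ≤ m → m + m₀ ≤ n → (∀ g : Fin (n + 1), ∀ u u' : Fin n → Bool, g.val ≤ m → (∀ i : Fin n, i.val < m → u i = u' i) → y g u = y g u') → (∀ g : Fin (n + 1), ∀ u u' : Fin n → Bool, m < g.val → (∀ i : Fin n, m ≤ i.val → u i = u' i) → y g u = y g u') → ((Finset.univ.filter fun u : Fin n → Bool => AdviceFreeQNC0.ringWinU c y u = true).card : ℝ) ≤ (8 / 9 + 8 * (2 : ℝ)⁻¹ ^ m₀) * (2 : ℝ) ^ n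

-- `BlindPairLaw` holds: proved by `Summit.QuantumAdvantage.QuantumAdvantage.Theorems.oddPrimeWalk_blindPairLaw` (its module imports this route file, so no `_holds` link can be stated here).

/-- item stmt-QuantumAdvantage-23991 · support · rank 9 · closed · proved by Summit.QuantumAdvantage.QuantumAdvantage.Theorems.oddPrimeWalk_localTwoThirdsLaw (prover) · by planner
[support] LOCAL TWO-THIRDS LAW (ROUND-28 THM 1⁺, k = 4; planner qa-qnc0-p2 g28/g29): a u-walk
strategy whose cut g reads only the bits i ∈ [g−w, g+w) (semantic reading radius w; fire-bit rules
otherwise ARBITRARY — no degree hypothesis) wins on ≤ (2/3 + 32·2^{-m₀})·2^n inputs at every charge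
c whenever 6w + 4m₀ ≤ n. So locality below n/6 forces the TRIVIAL value 2/3 (attained by "only cut n
fires"); the threshold side is sharp in kind: radius n/2 + 1 wins always (ROUND-28 §4.2, kit
j321234). Supersedes in range and value the tree rungs R7/R8 (`ringWinU_localRules_le`: radius
polylog, θ = 1 − η₀/4). Proof: choose separators m₁ < m₂ < m₃ with blocks of ≥ m₀ + (adjacent
windows) bits, FIX the 2w bits [m_j − w, m_j + w) around each separator (then no cut crosses any
separator: cut g ≤ m_j reads bits ≥ m_j only inside the fixed window, cut g > m_j reads bits < m_j
only inside it), apply the 4-block BLIND law on the free bits: trace formula WIN = Tr(ζ^{c+W} Σ_g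
y_g ζ^{g+W_g}), register R = Σ_j ζ^{F_0+…+F_{j−1}} r_j(u_j) (F_j = free weight of block j, r_j
arbitrary function of block j), successive best responses ⇒ WLOG r_j = f_j(F_j mod 3), finite core:
every deterministic profile of the -/
@[route_item "route-QuantumAdvantage-OddPrimeWalk"]
def LocalTwoThirdsLaw : Prop :=
  ∀ m₀ n w c : ℕ, ∀ y : Fin (n + 1) → (Fin n → Bool) → Bool, 6 * w + 4 * m₀ ≤ n → (∀ g : Fin (n + 1), ∀ u u' : Fin n → Bool, (∀ i : Fin n, g.val ≤ i.val + w → i.val < g.val + w → u i = u' i) → y g u = y g u') → ((Finset.univ.filter fun u : Fin n → Bool => AdviceFreeQNC0.ringWinU c y u = true).card : ℝ) ≤ (2 / 3 + 32 * (2 : ℝ)⁻¹ ^ m₀) * (2 : ℝ) ^ n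

-- `LocalTwoThirdsLaw` holds: proved by `Summit.QuantumAdvantage.QuantumAdvantage.Theorems.oddPrimeWalk_localTwoThirdsLaw` (its module imports this route file, so no `_holds` link can be stated here).

/-- item stmt-QuantumAdvantage-24030 · support · rank 9 · closed · proved by Summit.QuantumAdvantage.QuantumAdvantage.Theorems.oddPrimeWalk_farAffinePairLaw (prover) · by planner
[support] FAR-AFFINE PAIR LAW (cell qa-qnc0 p2 ROUND-29 §4, THM 29-A(ii); settles ROUND-28 Q28-D at
θ<1). p = 5 u-walk game ringWinU c: if across a separator m (both sides ≥ 64 bits) every cut g ≤ m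
is F₂-AFFINE in the bits i ≥ m and every cut g > m is F₂-affine in the bits i < m (own-side
dependence arbitrary; stated as vanishing of all 2-subcube sums in far directions; contains every
LinSel cut reading ≤ 1 far bit, every far-PARITY reader of any support, all permuted-local families
y_g=[u_{σ(g)}]), then #WIN ≤ (1 − 2⁻¹²)·2ⁿ. PROOF (complete, elementary; ROUND-29 §4.2–4.4): (1) F₄
register WIN = L_{c+a+b}(v,v′) + M_{c+2a+b}(v,v′), Σ_e L_e = Σ_e M_e = 0, L_e affine in v′ for fixed
v, M_e affine in v for fixed v′; (2) ODD-CONFIGURATION IDENTITY: for zero-sum triples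
(x_a,y_a,x_a+y_a) ⊂ class a (a=0,1,2) on each side, the 81 cross pairs contain an EVEN number of
wins, hence ≥ 1 loss; (3) averaging over uniform typical zero-sum triples (slot densities ≤ 1.02
w.r.t. uniform-on-class via the exact count #{y∈A_a : x+y∈A_a} = N_s(p)·N_{m−s}(q)) gives #LOSE ≥
min-cell/(9·1.05) ≥ 2ⁿ/86. True value conjecturally 8/9. Sketch:
HOME/qa-qnc0-p2/line29/Sketch29c.lean (rc 0). -/
@[route_item "route-QuantumAdvantage-OddPrimeWalk"]
def FarAffinePairLaw : Prop :=
  ∀ n m c : ℕ, ∀ y : Fin (n + 1) → (Fin n → Bool) → Bool, 64 ≤ m → m + 64 ≤ n → (∀ g : Fin (n + 1), g.val ≤ m → ∀ u : Fin n → Bool, ∀ S : Finset (Fin n), S.card = 2 → (∀ i ∈ S, m ≤ i.val) → (S.powerset.filter fun T => y g (fun i => Bool.xor (u i) (decide (i ∈ T))) = true).card % 2 = 0) → (∀ g : Fin (n + 1), m < g.val → ∀ u : Fin n → Bool, ∀ S : Finset (Fin n), S.card = 2 → (∀ i ∈ S, i.val < m) → (S.powerset.filter fun T => y g (fun i =>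 Bool.xor (u i) (decide (i ∈ T))) = true).card % 2 = 0) → ((Finset.univ.filter fun u : Fin n → Bool => Summit.QuantumAdvantage.AdviceFreeQNC0.ringWinU c y u = true).card : ℝ) ≤ (1 - (2 : ℝ)⁻¹ ^ 12) * (2 : ℝ) ^ n

-- `FarAffinePairLaw` holds: proved by `Summit.QuantumAdvantage.QuantumAdvantage.Theorems.oddPrimeWalk_farAffinePairLaw` (its module imports this route file, so no `_holds` link can be stated here).

/-- item stmt-QuantumAdvantage-24031 · support · rank 9 · closed · proved by Summit.QuantumAdvantage.QuantumAdvantage.Theorems.oddPrimeWalk_farDegreePairLaw (prover) · by planner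
[support] FAR-DEGREE PAIR LAW (cell qa-qnc0 p2 ROUND-29 §4, THM 29-A(iii); all d, existential
constants). p = 5 u-walk game ringWinU c: for every d there are θ_d < 1 and m₀ such that if across a
separator m (both sides ≥ m₀) every cut has F₂-degree ≤ d in the bits of the OTHER side (all
(d+1)-subcube sums in far directions vanish; own side arbitrary; contains every LinSel cut reading ≤
d far bits at arbitrary positions), then #WIN ≤ θ_d·2ⁿ. PROOF (ROUND-29 §4.2–4.5): F₄ register
decomposition WIN = L_{c+a+b}+M_{c+2a+b} as in FarAffinePairLaw; ODD-DESIGN IDENTITY: take per side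
the 3 multisets Q_a = { r + 1_S : S ∈ 𝒫_a } with r a common base vector (|r| ≡ 0 mod 3, support off
the ground set G) and 𝒫_a ⊂ 2^G an ODD family of sets of size ≡ a (mod 3) in which every T ⊆ G with
1 ≤ |T| ≤ d lies in an EVEN number of members (𝒫_0 = {∅}; 𝒫 = all 2^{k−1}-subsets of a (2^k−1)-set,
2^{k−1} > d, is such a family by Kummer/Lucas, and disjoint unions S∪S′ of two copies give the other
nonzero class); then Σ_{S∈𝒫_a} P(r+1_S) = P(r) for every P of degree ≤ d, so the (odd × odd) cross
configuration has an even number of wins ⇒ ≥ 1 loss; averaging with slot densities ≤ 2^{|G|} gives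
#LOSE ≥ 2ⁿ/(9·1.0 -/
@[route_item "route-QuantumAdvantage-OddPrimeWalk"]
def FarDegreePairLaw : Prop :=
  ∀ d : ℕ, ∃ θ : ℝ, θ < 1 ∧ ∃ m₀ : ℕ, ∀ n m c : ℕ, ∀ y : Fin (n + 1) → (Fin n → Bool) → Bool, m₀ ≤ m → m + m₀ ≤ n → (∀ g : Fin (n + 1), g.val ≤ m → ∀ u : Fin n → Bool, ∀ S : Finset (Fin n), S.card = d + 1 → (∀ i ∈ S, m ≤ i.val) → (S.powerset.filter fun T => y g (fun i => Bool.xor (u i) (decide (i ∈ T))) = true).card % 2 = 0) → (∀ g : Fin (n + 1), m < g.val → ∀ u : Fin n → Bool, ∀ S : Finset (Fin n), S.card = d + 1 → (∀ i ∈ S, i.val < m) → (S.powerset.filter fun T => y g (fun i => Bool.xor (u i) (decide (i ∈ T))) = true).card % 2 = 0) → ((Finset.univ.filter fun u : Fin n → Bool => Summit.QuantumAdvantage.AdviceFreeQNC0.ringWinU c y u = true).card : ℝ) ≤ θ * (2 : ℝ) ^ n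

-- `FarDegreePairLaw` holds: proved by `Summit.QuantumAdvantage.QuantumAdvantage.Theorems.oddPrimeWalk_farDegreePairLaw` (its module imports this route file, so no `_holds` link can be stated here).

/-- item stmt-QuantumAdvantage-24098 · support · rank 9 · closed · proved by Summit.QuantumAdvantage.QuantumAdvantage.Theorems.oddPrimeWalk_counterAffinePairLaw (prover) · by planner
[support] THM 30-A "counter-affine pair law" (ROUND-30 §2): at ONE balanced separator m (both sides
≥ m₀(q)), if every cut's dependence on the FOREIGN side is an 𝔽₂-affine function of the foreign bits
on each class {#foreign ones ≡ ρ (mod q)} — affine data (a₀, coefficient set A) depending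
ARBITRARILY on the cut's own side and on ρ, q % 3 ≠ 0 so the counter does not reveal the hidden
mod-3 class — then #WIN ≤ θ_q·2ⁿ with θ_q < 1. q = 1 (ρ-blind) is item 24030 FarAffinePairLaw
(CLOSED); new content: the class contains the (CORR-η) EXTREMISER family of ROUND-29 §3.5 (literal
parity × functions of |u| mod 5, i.e. tests [|u| + a·u_j ≡ c (mod 5)], corr 0.647·cos(π/30)^m),
which has high external rank and high 𝔽₂-degree, so no landed law (THM 2 / 24030 / 24031 / local
laws) covers it: the circuits that saturate the two-moduli rate LOSE the game. PROOF (paper,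
ROUND-30 §2.2): THM 29-A odd-configuration identity (tree: OddPrimeWalkFarAffinePairLaw engines,
planner's ConfigParity.lean `configParity`/`config_average`) with designs = zero-sum class triples
(x, y, x⊕y) lying in ONE weight class mod 3q on each side (exist: |x|=|y|=w, |x∧y|=t, w ≡ 2t (mod
3q)); (C2) holds because on a common ρ-c -/
@[route_item "route-QuantumAdvantage-OddPrimeWalk"]
def CounterAffinePairLaw : Prop :=
  ∀ q : ℕ, q % 3 ≠ 0 → ∃ θ : ℝ, θ < 1 ∧ ∃ m₀ : ℕ, ∀ n m c : ℕ, ∀ y : Fin (n + 1) → (Fin n → Bool) → Bool, m₀ ≤ m → m + m₀ ≤ n → (∀ g : Fin (n + 1), g.val ≤ m → ∃ a₀ : (Fin n → Bool) → ℕ → Bool, ∃ A : (Fin n → Bool) → ℕ → Finset (Fin n), ∀ u : Fin n → Bool, y g u = Bool.xor (a₀ (fun i => decide (i.val < m) && u i) ((Finset.univ.filter fun i : Fin n => m ≤ i.val ∧ u i = true).card % q)) (decide (((A (fun i => decide (i.val < m) && u i) ((Finset.univ.filter fun i : Fin n => m ≤ i.val ∧ u i = true).card % q)).filter fun i : Fin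 n => m ≤ i.val ∧ u i = true).card % 2 = 1))) → (∀ g : Fin (n + 1), m < g.val → ∃ a₀ : (Fin n → Bool) → ℕ → Bool, ∃ A : (Fin n → Bool) → ℕ → Finset (Fin n), ∀ u : Fin n → Bool, y g u = Bool.xor (a₀ (fun i => decide (m ≤ i.val) && u i) ((Finset.univ.filter fun i : Fin n => i.val < m ∧ u i = true).card % q)) (decide (((A (fun i => decide (m ≤ i.val) && u i) ((Finset.univ.filter fun i : Fin n => i.val < m ∧ u i = true).card % q)).filter fun i : Fin n => i.val < m ∧ u i = true).card % 2 = 1))) → ((Finset.univ.filter fun u : Fin n → Bool => Summit.QuantumAdvantage.AdviceFreeQNC0.ringWinU c y u = true).card : ℝ) ≤ θ * (2 : ℝ) ^ n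

/-- `CounterAffinePairLaw` holds: proved by `Summit.QuantumAdvantage.QuantumAdvantage.Theorems.oddPrimeWalk_counterAffinePairLaw`. -/
theorem CounterAffinePairLaw_holds : CounterAffinePairLaw := _root_.Summit.QuantumAdvantage.QuantumAdvantage.Theorems.oddPrimeWalk_counterAffinePairLaw

/-- item stmt-QuantumAdvantage-24120 · support · rank 9 · open · by planner
[support] WALK-MOD REDUCTION = THM 30-D (cell qa-qnc0 p2 ROUND-30 §3.6–§3.7; typed
HOME/qa-qnc0-p2/line30/Sketch30c.lean rc 0). HYPOTHESIS (WALK-MOD)(12,m₀), a ONE-CUBE two-moduli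
statement: on {0,1}^M (M ≥ n₀) a WALK-MODULATED mod-5 test sum Σ_{g∈G}[ (g+W_g(x)) mod 3 ∈ J
]·[β_g·x ∈ R_g] (W_g = prefix weight, |J| = 2, G ⊆ [0,M], some position g with m₀ < g < M−m₀
carrying a non-zero term) plus ANY plain parity of ≤ 12M mod-5 tests has bias ≤ 1−2ε₁ on every
weight-mod-3 class. CONCLUSION: the rung R5 `WalkHardFLinSel 5` (θ<1 for every linear-test strategy
of the p=5 u-walk game). PAPER PROOF (§3.7): F₄ register decomposition WIN = L_{c+a+b}+M_{c+2a+b}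
(FarAffinePairLaw); at separator m=⌊n/2⌋ Alice's used component is f_b(v)+P^v_b(x) (plain parity of
≤ 4(m+1) tests of x), Bob's is g_{2a}(x)+R^x_{2a}(v), R^x_{2a}(v)=Σ_{g>m}[g+|v|+W'_g(x) ∈
J'_{2a}]·[β_g·x ∈ R_g−α_g·v]; (W1): on WIN, P^v_b+R^x_{2a}(v) = 1+f_b(v)+g_{2a}(x); win density ≥
1−ε ⇒ for a.e. same-class pair v,v' the TWO-POINT IDENTITY Σ_{g>m: α_g·v≠α_g·v'} s_g(x)·[β_g·x ∈
(R_g−α_g v)Δ(R_g−α_g v')] = P^v_b+P^{v'}_b+const off density O(√ε) on each class B_b; (WALK-MOD)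
(end positions within m₀ absorbed into the plain side at O_ -/
@[route_item "route-QuantumAdvantage-OddPrimeWalk"]
def WalkModReductionR5 : Prop :=
  (∃ m₀ : ℕ, ∃ ε₁ : ℝ, 0 < ε₁ ∧ ∃ n₀ : ℕ, ∀ M ≥ n₀, ∀ (G : Finset ℕ) (J : Finset (ZMod 3)), J.card = 2 → ∀ (β : ℕ → Fin M → ZMod 5) (R : ℕ → Finset (ZMod 5)), (∃ g ∈ G, m₀ < g ∧ g + m₀ < M ∧ ∃ x : Fin M → Bool, (∑ i : Fin M, if x i then β g i else 0) ∈ R g) → ∀ K : ℕ, K ≤ 12 * M → ∀ (φ : Fin K → Fin M → ZMod 5) (r : Fin K → ZMod 5) (b : ZMod 3), |∑ x ∈ (Finset.univ.filter fun x : Fin M → Bool => (((Finset.univ.filter fun i : Fin M => x i = true).card : ℕ) : ZMod 3) = b), (-1 : ℝ) ^ ((G.filter fun g => (((g + (Finset.univ.filter fun i : Fin M => i.val < g ∧ x i = true).card : ℕ) : ZMod 3) ∈ J) ∧ (∑ i : Fin M, if x i then β g i else 0) ∈ R g).card + (Finset.univ.filter fun k : Fin K => (∑ i : Fin M, if x i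 then φ k i else 0) = r k).card)| ≤ (1 - 2 * ε₁) * ((Finset.univ.filter fun x : Fin M → Bool => (((Finset.univ.filter fun i : Fin M => x i = true).card : ℕ) : ZMod 3) = b).card : ℝ)) → ∀ (h5 : Fact (Nat.Prime 5)), @Summit.QuantumAdvantage.AdviceFreeQNC0.WalkHardFLinSel 5 h5

/-- item stmt-QuantumAdvantage-24150 · support · rank 9 · closed · proved by Summit.QuantumAdvantage.QuantumAdvantage.Theorems.oddPrimeWalk_fewFormsPairLaw (prover) · by planner
[support] THM 30-E `FewFormsPairLaw` (planner qa-qnc0-p2 g30, ROUND-30 §3.9;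
HOME/qa-qnc0-p2/line30/Sketch30e.lean rc 0). At one separator m: every cut at a position g ≤ m
equals (arbitrary function of the bits < m) XOR [φ_g · (bits ≥ m) ∈ R_g(bits < m)] where the cross
form φ_g is 0 (blind) or one of a LIST β of s linear forms mod 5 and the residue SET R_g depends
arbitrarily on the own bits; symmetrically for positions g > m with a list α of s forms on the bits
< m; s·K ≤ m and m + s·K ≤ n. Conclusion: #WIN(ringWinU c y) ≤ θ·2^n with θ < 1, K, m₀ absolute. s =
0 is item 23990 BlindPairLaw. ROLE: the endgame of the (WALK-MOD′) reduction of R5 `WalkHardFLinSel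
5` (THM 30-D′): it absorbs the Θ(log n) exceptional one-form end cuts forced by the end-depth caveat
(ROUND-30 §3.8) with room to spare. PROOF (paper, complete): `OddConfig.configParity` with index
types Fin 3 × Fin 3 and RANDOMISED designs p_a = r_A ⊕ z^{(a)} (r_A uniform off a ground block G_A ⊆
[0,m) of size L = 37s+73; z uniform on G_A, accepted iff its signature class under the s forms
α|_{G_A} is 1/15-balanced; the other two gadget vectors uniform in that class with the other two
weights mod 3) — one design point per cl -/
@[route_item "route-QuantumAdvantage-OddPrimeWalk"]
def FewFormsPairLaw : Prop :=
  ∃ θ : ℝ, θ < 1 ∧ ∃ K m₀ : ℕ, ∀ n m c s : ℕ, ∀ y : Fin (n + 1) → (Fin n → Bool) → Bool, m₀ ≤ m → m + m₀ ≤ n → s * K ≤ m → m + s * K ≤ n → ∀ α β : Fin s → Fin n → ZMod 5, (∀ g : Fin (n + 1), g.val ≤ m → ∃ f : (Fin n → Bool) → Bool, ∃ R : (Fin n → Bool) → Finset (ZMod 5), ∃ φ : Fin n → ZMod 5, (φ = 0 ∨ ∃ k, φ = β k) ∧ ∀ u : Fin n → Bool, y g u = Bool.xor (f (fun i => decide (i.val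 < m) && u i)) (decide ((∑ i : Fin n, if m ≤ i.val ∧ u i = true then φ i else 0) ∈ R (fun i => decide (i.val < m) && u i)))) → (∀ g : Fin (n + 1), m < g.val → ∃ f : (Fin n → Bool) → Bool, ∃ R : (Fin n → Bool) → Finset (ZMod 5), ∃ φ : Fin n → ZMod 5, (φ = 0 ∨ ∃ k, φ = α k) ∧ ∀ u : Fin n → Bool, y g u = Bool.xor (f (fun i => decide (m ≤ i.val) && u i)) (decide ((∑ i : Fin n, if i.val < m ∧ u i = true then φ i else 0) ∈ R (fun i => decide (m ≤ i.val) && u i)))) → ((Finset.univ.filter fun u : Fin n → Bool => Summit.QuantumAdvantage.AdviceFreeQNC0.ringWinU c y u = true).card : ℝ) ≤ θ * (2 : ℝ) ^ n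

-- `FewFormsPairLaw` holds: proved by `Summit.QuantumAdvantage.QuantumAdvantage.Theorems.oddPrimeWalk_fewFormsPairLaw` (its module imports this route file, so no `_holds` link can be stated here).

/-- item stmt-QuantumAdvantage-24167 · support · rank 9 · open · by planner
[support] FewSignaturesPairLaw (THM 30-E, signature form; ROUND-30 §3.9–§3.10,
HOME/qa-qnc0-p2/line30/Sketch30f.lean rc 0). At one separator m, fix s linear forms mod 5 on Bob's
bits (β, coordinates ≥ m) and s on Alice's bits (α, coordinates < m), with s·K ≤ m and m + s·K ≤ n.
Every cut at a position g ≤ m is an ARBITRARY function of (bits < m, the signature (β_k·x)_k of the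
bits ≥ m); every cut at g > m an arbitrary function of (bits ≥ m, the signature (α_k·v)_k of the
bits < m). Then #WIN ≤ θ·2^n with θ < 1, K, m₀ absolute (paper: K = 110, m₀ = 111, θ = 1 − 1/8100).
CONTAINS item 24150 FewFormsPairLaw (a cut f(x) ⊕ [φ·v ∈ R(x)] with φ ∈ {0} ∪ {α_k} is a function of
(x, signature)) and item 23990 BlindPairLaw (s = 0); SAME proof as 24150 (ROUND-30 §3.9):
OddConfig.configParity with randomised one-point-per-weight-class designs having EQUAL SIGNATURES
under all listed far forms — any function of (own bits, signature) is then class-independent across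
the design — slot marginals O(1)-dense by (ZS-bal) SignatureClassBalance (max_a |1 + ω ζ₅^a|² = 2 +
2cos 24° < 4). Prove THIS first; 24150 is a two-line corollary. Why it might fail: only through an
error in the randomised-design averag -/
@[route_item "route-QuantumAdvantage-OddPrimeWalk"]
def FewSignaturesPairLaw : Prop :=
  ∃ θ : ℝ, θ < 1 ∧ ∃ K m₀ : ℕ, ∀ n m c s : ℕ, ∀ y : Fin (n + 1) → (Fin n → Bool) → Bool, m₀ ≤ m → m + m₀ ≤ n → s * K ≤ m → m + s * K ≤ n → ∀ α β : Fin s → Fin n → ZMod 5, (∀ g : Fin (n + 1), g.val ≤ m → ∃ F : (Fin n → Bool) → (Fin s → ZMod 5) → Bool, ∀ u : Fin n → Bool, y g u = F (fun i => decide (i.val < m) && u i) (fun k => ∑ i : Fin n, if m ≤ i.val ∧ u i = true then β k i else 0)) → (∀ g : Fin (n + 1), m < g.val → ∃ F : (Fin n → Bool) → (Fin s → ZMod 5) → Bool, ∀ u : Fin n → Bool, y g u = F (fun i => decide (m ≤ i.val) && u i) (fun k => ∑ i : Fin n, if i.val < m ∧ u i = true then α k i else 0)) → ((Finset.univ.filter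 fun u : Fin n → Bool => Summit.QuantumAdvantage.AdviceFreeQNC0.ringWinU c y u = true).card : ℝ) ≤ θ * (2 : ℝ) ^ n

/-- item stmt-QuantumAdvantage-24199 · support · rank 9 · closed · proved by Summit.QuantumAdvantage.QuantumAdvantage.Theorems.oddPrimeWalk_endRegisterLawFive (prover) · by planner
[support] (E) END-REGISTER LAW at p = 5 (ROUND-31 §2.2, HOME/qa-qnc0-p2/line31/Sketch31.lean rc 0;
size S/M). Register coordinates: label λ_g(u) = (g + wtPrefix u g) mod 3, V_e(u) = #{g : y_g u ∧ λ_g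
≡ e}; ringWinU c y u ⇔ N + V_{−(c+wt u)} odd (rfl with ringWinU's definition). HYPOTHESIS: off ≤
δ·2ⁿ inputs the register is END-STRUCTURED: V_e(u) ≡ A_e(first D bits, L form values φ·u mod 5) +
B_{e − wt u}(last D bits, same form values) + κ(u) (mod 2) for all e (typed as: the parity of
count_e + [A … e] + [B … (e + 2·wt u) % 3] is independent of e ∈ range 3). CONCLUSION: #WIN_c ≤ (2/3
+ 2δ)·2ⁿ for n ≥ n₀(δ,D,L), for EVERY strategy y (no degree / LinSel hypothesis). PROOF (complete on
paper): for non-exceptional u with data d = (ends, φu) and class b = wt u mod 3, WIN ≡ ΣA + ΣB +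
A_{−c−b} + B_{−c−2b} =: F_d(b) and Σ_{b∈ℤ₃} F_d(b) ≡ 4ΣA + 4ΣB ≡ 0, so at most two classes win per
data value; wt u mod 3 is equidistributed given (2D end bits, L mod-5 form values) up to
5^L·2ⁿ·cos(12°)^{n−2D} by the two-moduli exponential sum (max_a |1+ωζ₅^a|/2 = cos π/15; tree:
Literature TwoModuliExpSums §8 TwoModuli.norm_sum_cell_pow_card_le, instantiated exactly as in
Theorems/OddPrimeWalkSignatureBalan -/
@[route_item "route-QuantumAdvantage-OddPrimeWalk"]
def EndRegisterLawFive : Prop :=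
  ∀ δ : ℝ, 0 < δ → ∀ D L : ℕ, ∃ n₀ : ℕ, ∀ n ≥ n₀, ∀ c : ℕ, ∀ y : Fin (n + 1) → (Fin n → Bool) → Bool, ∀ φ : Fin L → Fin n → ZMod 5, ∀ A B : (Fin n → Bool) → (Fin L → ZMod 5) → ℕ → Bool, ((Finset.univ.filter fun u : Fin n → Bool => ¬ (∀ e ∈ Finset.range 3, ∀ e' ∈ Finset.range 3, ((Finset.univ.filter fun g : Fin (n + 1) => y g u = true ∧ (g.val + Summit.QuantumAdvantage.AdviceFreeQNC0.wtPrefix u g.val) % 3 = e).card + (if A (fun i => decide (i.val < D) && u i) (fun k => ∑ i : Fin n, if u i = true then φ k i else 0) e = true then 1 else 0) + (if B (fun i => decide (n ≤ i.val + D) && u i) (fun k => ∑ i : Fin n, if u i = true then φ k i else 0) ((e + 2 * Summit.QuantumAdvantage.AdviceFreeQNC0.wt u) % 3) = true then 1 else 0)) % 2 = ((Finset.univ.filter fun g : Fin (n + 1) => y g u = true ∧ (g.val + Summit.QuantumAdvantage.AdviceFreeQNC0.wtPrefix u g.val) % 3 = e').card + (if A (fun i => decide (i.val < D) && u i) (fun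 k => ∑ i : Fin n, if u i = true then φ k i else 0) e' = true then 1 else 0) + (if B (fun i => decide (n ≤ i.val + D) && u i) (fun k => ∑ i : Fin n, if u i = true then φ k i else 0) ((e' + 2 * Summit.QuantumAdvantage.AdviceFreeQNC0.wt u) % 3) = true then 1 else 0)) % 2)).card : ℝ) ≤ δ * (2 : ℝ) ^ n → ((Finset.univ.filter fun u : Fin n → Bool => Summit.QuantumAdvantage.AdviceFreeQNC0.ringWinU c y u = true).card : ℝ) ≤ (2 / 3 + 2 * δ) * (2 : ℝ) ^ n

-- `EndRegisterLawFive` holds: proved by `Summit.QuantumAdvantage.QuantumAdvantage.Theorems.oddPrimeWalk_endRegisterLawFive` (its module imports this route file, so no `_holds` link can be stated here).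

/-- item stmt-QuantumAdvantage-24200 · support · rank 9 · open · by planner
[crux-candidate — RESEARCH statement; REFUTERS/DISPROVERS FIRST; provers: only the sub-cases below
via --supports, do not claim the whole item] (R₁) SINGLE-CLASS REGISTER RIGIDITY at p = 5 (ROUND-31
§2.3–§2.5, HOME/qa-qnc0-p2/line31/Sketch31.lean rc 0). For a LinSel-mod-5 strategy (ONE linear
residue test per cut position, register Σ_g [ℓ_g·u = r_g]·η^{g + wtPrefix u g} ∈ F₄): IF for ONE
charge c and ONE weight class {wt u ≡ b (3)} the win indicator ringWinU c y is ε₁-a.e. CONSTANT on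
that class, THEN the register is END-STRUCTURED on the WHOLE cube off δ·2ⁿ inputs: V_e(u) ≡
A_e(first D bits, L form values mod 5) + B_{e − wt u}(last D bits, same form values) + κ(u) (same
typed predicate as item EndRegisterLawFive). ROLE: (R₁) → (E) → R5 = WalkHardFLinSel 5 is item
RegisterRigidityReduction (pure logic: a near-perfect strategy is a.e. constant on every class; ONE
class suffices because the conclusion is whole-cube). WHY THIS SHAPE (vacuity census ROUND-31 §2.4):
every trace-level or ∃-end-list-per-cell weakening is vacuous (bare-at-n reproduces any cell
constant) and every 'all cells' version is R5 ∧ mirrors (pattern code {f(k)+g(k+b)}); hypothesis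
'near-perfect' would be R5's negat -/
@[route_item "route-QuantumAdvantage-OddPrimeWalk"]
def SingleClassRegisterRigidityFive : Prop :=
  ∀ δ : ℝ, 0 < δ → ∃ ε₁ : ℝ, 0 < ε₁ ∧ ∃ D L n₀ : ℕ, ∀ n ≥ n₀, ∀ h5 : Fact (Nat.Prime 5), ∀ y : Fin (n + 1) → (Fin n → Bool) → Bool, @Summit.QuantumAdvantage.AdviceFreeQNC0.LinSel 5 h5 n y → ∀ c b : ℕ, b < 3 → (((Finset.univ.filter fun u : Fin n → Bool => Summit.QuantumAdvantage.AdviceFreeQNC0.wt u % 3 = b ∧ Summit.QuantumAdvantage.AdviceFreeQNC0.ringWinU c y u = true).card : ℝ) ≤ ε₁ * ((Finset.univ.filter fun u : Fin n → Bool => Summit.QuantumAdvantage.AdviceFreeQNC0.wt u % 3 = b).card : ℝ) ∨ ((Finset.univ.filter fun u : Fin n → Bool => Summit.QuantumAdvantage.AdviceFreeQNC0.wt u % 3 = b ∧ Summit.QuantumAdvantage.AdviceFreeQNC0.ringWinU c y u = false).card : ℝ) ≤ ε₁ * ((Finset.univ.filter fun u : Fin n → Bool => Summit.QuantumAdvantage.AdviceFreeQNC0.wt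 u % 3 = b).card : ℝ)) → ∃ φ : Fin L → Fin n → ZMod 5, ∃ A B : (Fin n → Bool) → (Fin L → ZMod 5) → ℕ → Bool, ((Finset.univ.filter fun u : Fin n → Bool => ¬ (∀ e ∈ Finset.range 3, ∀ e' ∈ Finset.range 3, ((Finset.univ.filter fun g : Fin (n + 1) => y g u = true ∧ (g.val + Summit.QuantumAdvantage.AdviceFreeQNC0.wtPrefix u g.val) % 3 = e).card + (if A (fun i => decide (i.val < D) && u i) (fun k => ∑ i : Fin n, if u i = true then φ k i else 0) e = true then 1 else 0) + (if B (fun i => decide (n ≤ i.val + D) && u i) (fun k => ∑ i : Fin n, if u i = true then φ k i else 0) ((e + 2 * Summit.QuantumAdvantage.AdviceFreeQNC0.wt u) % 3) = true then 1 else 0)) % 2 = ((Finset.univ.filter fun g : Fin (n + 1) => y g u = true ∧ (g.val + Summit.QuantumAdvantage.AdviceFreeQNC0.wtPrefix u g.val) % 3 = e').card + (if A (fun i => decide (i.val < D) && u i) (fun k => ∑ i : Fin n, if u i = true then φ k i else 0) e' = true then 1 else 0) + (if B (fun i => decide (n ≤ i.val + D) && u i) (fun k => ∑ i : Fin n, if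 u i = true then φ k i else 0) ((e' + 2 * Summit.QuantumAdvantage.AdviceFreeQNC0.wt u) % 3) = true then 1 else 0)) % 2)).card : ℝ) ≤ δ * (2 : ℝ) ^ n

/-- item stmt-QuantumAdvantage-24201 · support · rank 9 · closed · proved by Summit.QuantumAdvantage.QuantumAdvantage.Theorems.oddPrimeWalk_registerRigidityReduction (prover) · by planner
[support] ARCHITECTURE-31 REDUCTION (ROUND-31 §2.3; HOME/qa-qnc0-p2/line31/Sketch31.lean rc 0; size
S, pure logic + class sizes): (item SingleClassRegisterRigidityFive, stmt-QuantumAdvantage-24200) →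
(item EndRegisterLawFive, stmt-QuantumAdvantage-24199) → WalkHardFLinSel 5 (= R5,
AdviceFreeQNC0/LinearSelections.lean). The two hypotheses are those items VERBATIM (SigTest31.lean:
rfl). PROOF: fix δ := 1/100, get ε₁, D, L, n₀ from (R₁); put ε := ε₁/4, θ := 1 − ε; take n ≥ max(n₀,
n₀′(δ,D,L) of (E), small-n slack). If a LinSel y had #WIN_c > θ·2ⁿ then #LOSE < ε·2ⁿ ≤ ε₁·|B_0|
(class sizes: 3|B_b| + 2 ≥ 2ⁿ, tree three_mul_card_class_add_two_ge / card_Acl-style lemmas in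
Theorems/OddPrimeWalkBlindPairLaw.lean), so the hypothesis of (R₁) holds at (c, b = 0) and yields φ,
A, B with exception set ≤ δ·2ⁿ on the WHOLE cube; (E) then gives #WIN_c ≤ (2/3 + 2δ)·2ⁿ < θ·2ⁿ —
contradiction. Why it might fail: it cannot, short of a typo in the inlined hypotheses (checked rfl
against the two items). Value: makes (R₁) + (E) an honest closing pair for R5 (the OddPrimeWalk
rung-5 leaf via LinSelOfWalkHardF is NOT claimed — R5 is WalkHardFLinSel 5 itself). Sources:
ROUND-31 §2.3. -/
@[route_item "route-QuantumAdvantage-OddPrimeWalk"]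
def RegisterRigidityReduction : Prop :=
  (∀ δ : ℝ, 0 < δ → ∃ ε₁ : ℝ, 0 < ε₁ ∧ ∃ D L n₀ : ℕ, ∀ n ≥ n₀, ∀ h5 : Fact (Nat.Prime 5), ∀ y : Fin (n + 1) → (Fin n → Bool) → Bool, @Summit.QuantumAdvantage.AdviceFreeQNC0.LinSel 5 h5 n y → ∀ c b : ℕ, b < 3 → (((Finset.univ.filter fun u : Fin n → Bool => Summit.QuantumAdvantage.AdviceFreeQNC0.wt u % 3 = b ∧ Summit.QuantumAdvantage.AdviceFreeQNC0.ringWinU c y u = true).card : ℝ) ≤ ε₁ * ((Finset.univ.filter fun u : Fin n → Bool => Summit.QuantumAdvantage.AdviceFreeQNC0.wt u % 3 = b).card : ℝ) ∨ ((Finset.univ.filter fun u : Fin n → Bool => Summit.QuantumAdvantage.AdviceFreeQNC0.wt u % 3 = b ∧ Summit.QuantumAdvantage.AdviceFreeQNC0.ringWinU c y u = false).card : ℝ) ≤ ε₁ * ((Finset.univ.filter fun u : Fin n → Bool => Summit.QuantumAdvantage.AdviceFreeQNC0.wt u % 3 = b).card : ℝ)) → ∃ φ : Fin L → Fin n → ZMod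 5, ∃ A B : (Fin n → Bool) → (Fin L → ZMod 5) → ℕ → Bool, ((Finset.univ.filter fun u : Fin n → Bool => ¬ (∀ e ∈ Finset.range 3, ∀ e' ∈ Finset.range 3, ((Finset.univ.filter fun g : Fin (n + 1) => y g u = true ∧ (g.val + Summit.QuantumAdvantage.AdviceFreeQNC0.wtPrefix u g.val) % 3 = e).card + (if A (fun i => decide (i.val < D) && u i) (fun k => ∑ i : Fin n, if u i = true then φ k i else 0) e = true then 1 else 0) + (if B (fun i => decide (n ≤ i.val + D) && u i) (fun k => ∑ i : Fin n, if u i = true then φ k i else 0) ((e + 2 * Summit.QuantumAdvantage.AdviceFreeQNC0.wt u) % 3) = true then 1 else 0)) % 2 = ((Finset.univ.filter fun g : Fin (n + 1) => y g u = true ∧ (g.val + Summit.QuantumAdvantage.AdviceFreeQNC0.wtPrefix u g.val) % 3 = e').card + (if A (fun i => decide (i.val < D) && u i) (fun k => ∑ i : Fin n, if u i = true then φ k i else 0) e' = true then 1 else 0) + (if B (fun i => decide (n ≤ i.val + D) && u i) (fun k => ∑ i : Fin n, if u i = true then φ k i else 0) ((e' + 2 * Summit.QuantumAdvantage.AdviceFreeQNC0.wt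 u) % 3) = true then 1 else 0)) % 2)).card : ℝ) ≤ δ * (2 : ℝ) ^ n) → (∀ δ : ℝ, 0 < δ → ∀ D L : ℕ, ∃ n₀ : ℕ, ∀ n ≥ n₀, ∀ c : ℕ, ∀ y : Fin (n + 1) → (Fin n → Bool) → Bool, ∀ φ : Fin L → Fin n → ZMod 5, ∀ A B : (Fin n → Bool) → (Fin L → ZMod 5) → ℕ → Bool, ((Finset.univ.filter fun u : Fin n → Bool => ¬ (∀ e ∈ Finset.range 3, ∀ e' ∈ Finset.range 3, ((Finset.univ.filter fun g : Fin (n + 1) => y g u = true ∧ (g.val + Summit.QuantumAdvantage.AdviceFreeQNC0.wtPrefix u g.val) % 3 = e).card + (if A (fun i => decide (i.val < D) && u i) (fun k => ∑ i : Fin n, if u i = true then φ k i else 0) e = true then 1 else 0) + (if B (fun i => decide (n ≤ i.val + D) && u i) (fun k => ∑ i : Fin n, if u i = true then φ k i else 0) ((e + 2 * Summit.QuantumAdvantage.AdviceFreeQNC0.wt u) % 3) = true then 1 else 0)) % 2 = ((Finset.univ.filter fun g : Fin (n + 1) => y g u = true ∧ (g.val + Summit.QuantumAdvantage.AdviceFreeQNC0.wtPrefix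 u g.val) % 3 = e').card + (if A (fun i => decide (i.val < D) && u i) (fun k => ∑ i : Fin n, if u i = true then φ k i else 0) e' = true then 1 else 0) + (if B (fun i => decide (n ≤ i.val + D) && u i) (fun k => ∑ i : Fin n, if u i = true then φ k i else 0) ((e' + 2 * Summit.QuantumAdvantage.AdviceFreeQNC0.wt u) % 3) = true then 1 else 0)) % 2)).card : ℝ) ≤ δ * (2 : ℝ) ^ n → ((Finset.univ.filter fun u : Fin n → Bool => Summit.QuantumAdvantage.AdviceFreeQNC0.ringWinU c y u = true).card : ℝ) ≤ (2 / 3 + 2 * δ) * (2 : ℝ) ^ n) → ∀ h5 : Fact (Nat.Prime 5), @Summit.QuantumAdvantage.AdviceFreeQNC0.WalkHardFLinSel 5 h5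

/-- `RegisterRigidityReduction` holds: proved by `Summit.QuantumAdvantage.QuantumAdvantage.Theorems.oddPrimeWalk_registerRigidityReduction`. -/
theorem RegisterRigidityReduction_holds : RegisterRigidityReduction := _root_.Summit.QuantumAdvantage.QuantumAdvantage.Theorems.oddPrimeWalk_registerRigidityReduction

/-- item stmt-QuantumAdvantage-24205 · support · rank 9 · open · by planner
[support, M/L — the FINITE-STATE case of Architecture 31; provable; BC5-type rung for item
SingleClassRegisterRigidityFive stmt-QuantumAdvantage-24200] (R₁-FS) FINITE-STATE REGISTER RIGIDITY
at p = 5 (ROUND-31 §3.4; HOME/qa-qnc0-p2/line31/Sketch31.lean rc 0). CLASS: every cut y_g is an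
ARBITRARY Boolean function F_g of (wtPrefix u g mod 5, wt u mod 5, the window of 2w bits [g−w, g+w))
— contains rung (G) FiniteStateRungFive / M19 counter strategies (w = 0), window-local strategies,
and their Boolean combinations; position-dependent F_g allowed (no periodicity).
HYPOTHESIS/CONCLUSION exactly as in 24200: win indicator ε₁-a.e. constant on ONE class {wt u ≡ b
(3)} for ONE charge ⇒ register END-STRUCTURED on the whole cube off δ·2ⁿ (V_e ≡ A_e(first D bits,
form values) + B_{e−wt u}(last D bits, form values) + κ; here L = 1 suffices: φ = all-ones form = wt
mod 5, D = O(w + log 1/ε₁)). This is a STRUCTURE theorem (register level), strictly more than the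
game bound of rung (G). PROOF PLAN (two lemmas): (1) ANALYTIC — twisted transfer operators of the
chain σ_n = (wtPrefix mod 15, last 2w bits) (tree:
WalkFiniteStateRung{Transfer,Contraction,Equidist}.lean, qn-lit Literature TwistedTransfe -/
@[route_item "route-QuantumAdvantage-OddPrimeWalk"]
def FiniteStateRegisterRigidityFive : Prop :=
  ∀ w : ℕ, ∀ δ : ℝ, 0 < δ → ∃ ε₁ : ℝ, 0 < ε₁ ∧ ∃ D L n₀ : ℕ, ∀ n ≥ n₀, ∀ y : Fin (n + 1) → (Fin n → Bool) → Bool, (∀ g : Fin (n + 1), ∃ F : ZMod 5 → ZMod 5 → (Fin n → Bool) → Bool, ∀ u : Fin n → Bool, y g u = F ((Summit.QuantumAdvantage.AdviceFreeQNC0.wtPrefix u g.val : ℕ) : ZMod 5) ((Summit.QuantumAdvantage.AdviceFreeQNC0.wt u : ℕ) : ZMod 5) (fun i => decide (g.val ≤ i.val + w ∧ i.val < g.val + w) && u i)) → ∀ c b : ℕ, b < 3 → (((Finset.univ.filter fun u : Fin n → Bool => Summit.QuantumAdvantage.AdviceFreeQNC0.wt u % 3 = b ∧ Summit.QuantumAdvantage.AdviceFreeQNC0.ringWinU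 c y u = true).card : ℝ) ≤ ε₁ * ((Finset.univ.filter fun u : Fin n → Bool => Summit.QuantumAdvantage.AdviceFreeQNC0.wt u % 3 = b).card : ℝ) ∨ ((Finset.univ.filter fun u : Fin n → Bool => Summit.QuantumAdvantage.AdviceFreeQNC0.wt u % 3 = b ∧ Summit.QuantumAdvantage.AdviceFreeQNC0.ringWinU c y u = false).card : ℝ) ≤ ε₁ * ((Finset.univ.filter fun u : Fin n → Bool => Summit.QuantumAdvantage.AdviceFreeQNC0.wt u % 3 = b).card : ℝ)) → ∃ φ : Fin L → Fin n → ZMod 5, ∃ A B : (Fin n → Bool) → (Fin L → ZMod 5) → ℕ → Bool, ((Finset.univ.filter fun u : Fin n → Bool => ¬ (∀ e ∈ Finset.range 3, ∀ e' ∈ Finset.range 3, ((Finset.univ.filter fun g : Fin (n + 1) => y g u = true ∧ (g.val + Summit.QuantumAdvantage.AdviceFreeQNC0.wtPrefix u g.val) % 3 = e).card + (if A (fun i => decide (i.val < D) && u i) (fun k => ∑ i : Fin n, if u i = true then φ k i else 0) e = true then 1 else 0) + (if B (fun i => decide (n ≤ i.val + D) && u i) (fun k => ∑ i : Fin n, if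 u i = true then φ k i else 0) ((e + 2 * Summit.QuantumAdvantage.AdviceFreeQNC0.wt u) % 3) = true then 1 else 0)) % 2 = ((Finset.univ.filter fun g : Fin (n + 1) => y g u = true ∧ (g.val + Summit.QuantumAdvantage.AdviceFreeQNC0.wtPrefix u g.val) % 3 = e').card + (if A (fun i => decide (i.val < D) && u i) (fun k => ∑ i : Fin n, if u i = true then φ k i else 0) e' = true then 1 else 0) + (if B (fun i => decide (n ≤ i.val + D) && u i) (fun k => ∑ i : Fin n, if u i = true then φ k i else 0) ((e' + 2 * Summit.QuantumAdvantage.AdviceFreeQNC0.wt u) % 3) = true then 1 else 0)) % 2)).card : ℝ) ≤ δ * (2 : ℝ) ^ n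

/-- item stmt-QuantumAdvantage-24252 · support · rank 9 · closed · proved by Summit.QuantumAdvantage.QuantumAdvantage.Theorems.oddPrimeWalk_threeBlindBitsLaw (prover) · by planner
[support] BLIND-BITS LAW (planner qa-qnc0-p2 g32, ROUND-32 §2; HOME/qa-qnc0-p2/line32/Sketch32.lean
rc 0). In the u-walk game at ANY charge c, a strategy y with ARBITRARY fire rules that ignores three
bits i<j<k (y g (update u i b) = y g u, same for j, k) wins at most 7/8·2^n inputs. TIGHT: 7/8 is
attained for every n ≥ 5 (line32/blind_direct.py, exact optimum over all blind strategies, n =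
5,6,7); with four ignored bits the constant is 3/4 (Sketch32.FourBlindBitsLaw), five 23/32, six
11/16, θ_k ↓ 2/3 (line32/blind_max.py). PROOF (S/M): fibre over the other n−3 bits; on a fibre the
fired set F is fixed (blindness) and by WalkCoreGenuineRow.ringWinU_eq_trace WIN(u^S) = (ω^{c+wt
u⁰+|S|}·Σ_{j=0..3} ω^{s_j} Z_j).2 with segment registers Z_j = t4sum over fired g with i_j < g ≤
i_{j+1} of ω^{g+wtPrefix u⁰ g} ∈ T4 and s_j = |S ∩ {i_1..i_j}| (flipping blind bit p shifts the
labels of exactly the cuts g > p); finite core: for every charge class and every Z ∈ T4^4 at least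
one of the 8 completions S loses — `decide` over 3·4^4·8 cases (line32/unread_bits.py: ALL-CLASSES
k=3 κ=1 has no solution); hence ≥ 2^{n−3} losses. Tree vocabulary: T4/tOmegaPow/t4sum
(CrossTeam.lean), profile/ringWinU_eq -/
@[route_item "route-QuantumAdvantage-OddPrimeWalk"]
def ThreeBlindBitsLaw : Prop :=
  ∀ (n c : ℕ) (y : Fin (n + 1) → (Fin n → Bool) → Bool) (i j k : Fin n), i < j → j < k → (∀ g u b, y g (Function.update u i b) = y g u) → (∀ g u b, y g (Function.update u j b) = y g u) → (∀ g u b, y g (Function.update u k b) = y g u) → 8 * (Finset.univ.filter fun u : Fin n → Bool => Summit.QuantumAdvantage.AdviceFreeQNC0.ringWinU c y u = true).card ≤ 7 * 2 ^ n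

/-- `ThreeBlindBitsLaw` holds: proved by `Summit.QuantumAdvantage.QuantumAdvantage.Theorems.oddPrimeWalk_threeBlindBitsLaw`. -/
theorem ThreeBlindBitsLaw_holds : ThreeBlindBitsLaw := _root_.Summit.QuantumAdvantage.QuantumAdvantage.Theorems.oddPrimeWalk_threeBlindBitsLaw

/-- item stmt-QuantumAdvantage-24253 · support · rank 9 · closed · proved by Summit.QuantumAdvantage.QuantumAdvantage.Theorems.oddPrimeWalk_fourBlindBitsInnerNull (prover) · by planner
[support] FOUR BLIND BITS ⇒ INNER SEGMENT NULL (planner qa-qnc0-p2 g32, ROUND-32 §2.3;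
HOME/qa-qnc0-p2/line32/Sketch32.lean rc 0). The (R1)-shaped EXACT rigidity in its first
non-finite-state instance: y ignores bits i₁<i₂<i₃<i₄ (fire rules otherwise ARBITRARY — interior
cuts may read every other bit), u a base point vanishing at the four positions, b a weight class; if
the win bit ringWinU c y is CONSTANT over the completions u∨S, S ⊆ {i₁..i₄}, of class (wt u + |S|) ≡
b (mod 3) (each class has ≥ 5 of the 16 completions), then the fired cuts g ∈ (i₂, i₃] have label
counts N_e = #{g fired : i₂<g≤i₃, (g + wtPrefix u g) ≡ e (3)} with N_0 ≡ N_1 ≡ N_2 (mod 2), i.e. the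
inner segment register Σ ω^{label} vanishes in F₄. VERIFIED: F₄ enumeration (line32/unread_bits2.py:
one class, k=4, every (κ, m₀): exactly 32 solutions, all with z₂ = 0) and directly on game instances
(line32/blind_inner_direct.py, n=7: 1650 hypothesis instances, 0 violations; controls k=3 / outer
segment do violate). PROOF (S/M): as ThreeBlindBitsLaw (stmt-QuantumAdvantage-24252) — per fibre
WIN(u∨S) = (ω^{c+wt u+|S|} Σ_{j=0..4} ω^{s_j} Z_j).2, Z_j ∈ T4 the segment registers; finite core
`decide`: ∀ c b, ∀ Z ∈ T4^5, con -/
@[route_item "route-QuantumAdvantage-OddPrimeWalk"]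
def FourBlindBitsInnerNull : Prop :=
  ∀ (n c : ℕ) (y : Fin (n + 1) → (Fin n → Bool) → Bool) (i₁ i₂ i₃ i₄ : Fin n), i₁ < i₂ → i₂ < i₃ → i₃ < i₄ → (∀ g u b, y g (Function.update u i₁ b) = y g u) → (∀ g u b, y g (Function.update u i₂ b) = y g u) → (∀ g u b, y g (Function.update u i₃ b) = y g u) → (∀ g u b, y g (Function.update u i₄ b) = y g u) → ∀ u : Fin n → Bool, u i₁ = false → u i₂ = false → u i₃ = false → u i₄ = false → ∀ b : ℕ, b < 3 → (∀ S S' : Finset (Fin n), S ⊆ {i₁, i₂, i₃, i₄} → S' ⊆ {i₁, i₂, i₃, i₄} → (Summit.QuantumAdvantage.AdviceFreeQNC0.wt u + S.card) % 3 = b → (Summit.QuantumAdvantage.AdviceFreeQNC0.wt u + S'.card) % 3 = b → Summit.QuantumAdvantage.AdviceFreeQNC0.ringWinU c y (fun i => u i || decide (i ∈ S)) = Summit.QuantumAdvantage.AdviceFreeQNC0.ringWinU c y (fun i => u i || decide (i ∈ S'))) → ∀ e < 3, ∀ e' < 3, (Finset.univ.filter fun g : Fin (n + 1) => y g u = true ∧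 i₂.val < g.val ∧ g.val ≤ i₃.val ∧ (g.val + Summit.QuantumAdvantage.AdviceFreeQNC0.wtPrefix u g.val) % 3 = e).card % 2 = (Finset.univ.filter fun g : Fin (n + 1) => y g u = true ∧ i₂.val < g.val ∧ g.val ≤ i₃.val ∧ (g.val + Summit.QuantumAdvantage.AdviceFreeQNC0.wtPrefix u g.val) % 3 = e').card % 2

/-- `FourBlindBitsInnerNull` holds: proved by `Summit.QuantumAdvantage.QuantumAdvantage.Theorems.oddPrimeWalk_fourBlindBitsInnerNull`. -/
theorem FourBlindBitsInnerNull_holds : FourBlindBitsInnerNull := _root_.Summit.QuantumAdvantage.QuantumAdvantage.Theorems.oddPrimeWalk_fourBlindBitsInnerNull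

/-- item stmt-QuantumAdvantage-24257 · support · rank 9 · closed · proved by Summit.QuantumAdvantage.QuantumAdvantage.Theorems.oddPrimeWalk_multiCounterRungFive (prover) · by planner
[support, L] MULTI-COUNTER / BOUNDED-RANK RUNG at p = 5 (planner qa-qnc0-p2 g32, ROUND-32 §3).
CLASS: a colouring κ : Fin n → Fin K; every cut fires by an ARBITRARY function T_g of the K class
counters W_k(u) mod 5. Covers LinSel of rank L (all forms in an L-dim subspace of F_5^n; K = 5^L):
the first dense FAR-READING non-finite-state class, the rank ladder whose top is R5 =
WalkHardFLinSel 5 (rank unbounded). CLAIM: one θ < 1 for all K (value → 2/3), n ≥ n₀(K). WHY TRUE /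
PLAN (primary, Markov): given σ = (W_k mod 5)_k the strategy is INPUT-INDEPENDENT (fired set F_σ
fixed) and the input is a BRIDGE of the translation chain s_g = (W_{<g} mod 3, (W_{k,<g} mod 5)_k)
on S = Z_3 × Z_5^K (step at position g: s ↦ s + u_g·τ_{κ(g)}, τ_k = (1, e_k)); WIN = Σ_{g ∈ F_σ} h(c
+ b + g + s_g.1) mod 2 (h(x) = [x ≢ 0 (3)]) is an additive site functional. (1) Micro-blocks of
length m₀ = 28K; freeze (condition on) the bits of every class with < 28 positions in its
micro-block and of every class of size ≤ 5; every micro-block keeps ≥ 28 free bits of one class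
(pigeonhole), no deserts. (2) BRIDGE COBOUNDARY for abelian translation chains on the bridge support
(generalise Literature.Probability.MarkovC -/
@[route_item "route-QuantumAdvantage-OddPrimeWalk"]
def MultiCounterRungFive : Prop :=
  ∃ θ : ℝ, θ < 1 ∧ ∀ K : ℕ, ∃ n₀ : ℕ, ∀ n ≥ n₀, ∀ c : ℕ, ∀ κ : Fin n → Fin K, ∀ T : Fin (n + 1) → (Fin K → ZMod 5) → Bool, ∀ y : Fin (n + 1) → (Fin n → Bool) → Bool, (∀ g u, y g u = T g (fun k => (((Finset.univ.filter fun i : Fin n => κ i = k ∧ u i = true).card : ℕ) : ZMod 5))) → ((Finset.univ.filter fun u : Fin n → Bool => Summit.QuantumAdvantage.AdviceFreeQNC0.ringWinU c y u = true).card : ℝ) ≤ θ * (2 : ℝ) ^ n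

/-- `MultiCounterRungFive` holds: proved by `Summit.QuantumAdvantage.QuantumAdvantage.Theorems.oddPrimeWalk_multiCounterRungFive`. -/
theorem MultiCounterRungFive_holds : MultiCounterRungFive := _root_.Summit.QuantumAdvantage.QuantumAdvantage.Theorems.oddPrimeWalk_multiCounterRungFive

/-- item stmt-QuantumAdvantage-24270 · support · rank 9 · closed · proved by Summit.QuantumAdvantage.QuantumAdvantage.Theorems.oddPrimeWalk_logMultiplicityRungFive (prover) · by planner
[support, M] LOW-RESOLUTION (LOG-MULTIPLICITY) RUNG at p = 5 (planner qa-qnc0-p2 g32, ROUND-32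
§3bis, plan γ in HOME/qa-qnc0-p2/line32/PROOF-MC.md). CLASS: a colouring κ : Fin n → Fin K in which
EVERY class has ≥ C·log₂ n members ("every coefficient column of the form system is shared by ≥ C
log n bits"); every cut fires by an ARBITRARY function T_g of the class counters mod 5. Covers
LinSel systems of column-multiplicity ≥ C log n (rank up to n / (C log n)): far-reading, dense,
non-finite-state. CLAIM: value ≤ θ for EVERY θ > 2/3, n ≥ n₀(θ) (C = C(θ); C = 64 works). PROOF
(plan γ = TWO-MODULI DECORRELATION AT THE CHAIN LEVEL — mod-5 counters of large classes are
useless): (γ1) ORDER-3 CONTRACTION: the F₄-register chain X = (z, r) ∈ ℤ₃ × F₄ (z = W_{<i} mod 3, r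
+= [i ∈ F]·ω^{i+z}, then z += u_i) has two branch PERMUTATIONS P₀, P₁ per position with (P₁⁻¹P₀)³ =
1 (P₁⁻¹P₀ (z,r) = (z−1, r + f(z) − f(z−1))); hence for a ∈ {1,2,3,4}, ‖(P₀ + e^{2πia/5}P₁)/2‖_{ℓ²} ≤
cos(π/15) (a unitary of order 3 has eigenphases 0, ±2π/3; (1 + cos 24°)/2 = cos² 12°) — verified
numerically for all 24 cases, line32/twist_norm.py: worst = 0.978148 = cos(π/15) exactly. (γ2)
TWISTED TRANSFER BOUND: for a FIXED -/
@[route_item "route-QuantumAdvantage-OddPrimeWalk"]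
def LogMultiplicityRungFive : Prop :=
  ∀ θ : ℝ, 2 / 3 < θ → ∃ C n₀ : ℕ, ∀ n ≥ n₀, ∀ c K : ℕ, ∀ κ : Fin n → Fin K, (∀ i : Fin n, C * Nat.log 2 n ≤ (Finset.univ.filter fun i' : Fin n => κ i' = κ i).card) → ∀ T : Fin (n + 1) → (Fin K → ZMod 5) → Bool, ∀ y : Fin (n + 1) → (Fin n → Bool) → Bool, (∀ g u, y g u = T g (fun k => (((Finset.univ.filter fun i : Fin n => κ i = k ∧ u i = true).card : ℕ) : ZMod 5))) → ((Finset.univ.filter fun u : Fin n → Bool => Summit.QuantumAdvantage.AdviceFreeQNC0.ringWinU c y u = true).card : ℝ) ≤ θ * (2 : ℝ) ^ n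

/-- `LogMultiplicityRungFive` holds: proved by `Summit.QuantumAdvantage.QuantumAdvantage.Theorems.oddPrimeWalk_logMultiplicityRungFive`. -/
theorem LogMultiplicityRungFive_holds : LogMultiplicityRungFive := _root_.Summit.QuantumAdvantage.QuantumAdvantage.Theorems.oddPrimeWalk_logMultiplicityRungFive

/-- item stmt-QuantumAdvantage-24271 · support · rank 9 · closed · proved by Summit.QuantumAdvantage.QuantumAdvantage.Theorems.oddPrimeWalk_boundedJuntaRungFive (prover) · by planner
[support, S/M] BOUNDED-JUNTA RUNG at p = 5 (planner qa-qnc0-p2 g32, ROUND-32 §3bis): a strategy all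
of whose cuts depend on at most q FIXED input bits (positions Q, |Q| ≤ q; ANY functions) wins ≤ θ·2ⁿ
for every θ > 2/3, n ≥ n₀(q, θ). Equivalently: the blind-bits constants θ_k of ROUND-32 §2.2 / item
24252 (θ_k = max over Z ∈ F₄^{k+1} of the fraction of winning completions of a k-blind-bit fibre; 1,
1, 7/8, 3/4, 23/32, 11/16 for k = 1..6, line32/blind_max.py) DECREASE TO 2/3: per fibre of u|_Q the
game is the BARE WALK WITH F₄ COEFFICIENTS — free bits b_1..b_{n−q} fair, s_j = b_1 + … + b_j, WIN =
Tr(ω^{e+s_{n−q}} Σ_j β_j ω^{s_j}) with ARBITRARY β_j ∈ F₄ (β_j = register of the cuts in the j-th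
gap of Q, labels shifted by the known bits; WalkCoreGenuineRow.ringWinU_eq_trace) — and the claim is
sup_β P(WIN) ≤ 2/3 + o(1) as the number of free bits → ∞. PROOF ROUTE: adapt the bare-walk 2/3
theorem (tree: twoStepFiniteStateWalkHard_five, files
WalkFiniteStateRung{Sparse,Dense,Transfer,Equidist,Contraction}.lean: sparse-active regime = window
+ twisted three-charge identity twistedNotAllThree; dense-active regime = parity contraction ‖PDP‖ <
1) from coefficients ω^j·[fired] to arbitrary β_ -/
@[route_item "route-QuantumAdvantage-OddPrimeWalk"]
def BoundedJuntaRungFive : Prop :=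
  ∀ q : ℕ, ∀ θ : ℝ, 2 / 3 < θ → ∃ n₀ : ℕ, ∀ n ≥ n₀, ∀ c : ℕ, ∀ Q : Finset (Fin n), Q.card ≤ q → ∀ y : Fin (n + 1) → (Fin n → Bool) → Bool, (∀ g u u', (∀ i ∈ Q, u i = u' i) → y g u = y g u') → ((Finset.univ.filter fun u : Fin n → Bool => Summit.QuantumAdvantage.AdviceFreeQNC0.ringWinU c y u = true).card : ℝ) ≤ θ * (2 : ℝ) ^ n

/-- `BoundedJuntaRungFive` holds: proved by `Summit.QuantumAdvantage.QuantumAdvantage.Theorems.oddPrimeWalk_boundedJuntaRungFive`. -/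
theorem BoundedJuntaRungFive_holds : BoundedJuntaRungFive := _root_.Summit.QuantumAdvantage.QuantumAdvantage.Theorems.oddPrimeWalk_boundedJuntaRungFive

/-- item stmt-QuantumAdvantage-24278 · support · rank 9 · closed · proved by Summit.QuantumAdvantage.QuantumAdvantage.Theorems.oddPrimeWalk_columnResolutionRungFive (prover) · by planner
[support, M+] COLUMN-RESOLUTION RUNG at p = 5 — THE theorem of the low-resolution line (planner
qa-qnc0-p2 g32, ROUND-32 §3bis; plan γ in HOME/qa-qnc0-p2/line32/PROOF-MC.md): a strategy that
depends on the input u only through (i) the bits in an arbitrary set S (ANY size, ANY functions) and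
(ii) the counters mod 5 of the classes of a colouring κ of the remaining bits, all of whose classes
have ≥ C·log₂ n members, wins ≤ θ·2ⁿ for every θ > 2/3, n ≥ n₀(θ). COROLLARIES: stmt-24270
LogMultiplicityRungFive (S = ∅), stmt-24257 MultiCounterRungFive (S := union of the classes of size
< L₀(K, θ)), stmt-24271 BoundedJuntaRungFive (S := Q, one big class; strategies reading only u|_Q),
and every LinSel system whose coefficient COLUMNS outside S are shared by ≥ C log n bits each.
PROOF: condition on u|_S = π (FIBREWISE — each fibre separately); inside a fibre the strategy is
multi-counter over the large classes with a π-dependent table; run the 12-state register chain (z,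
r) ∈ ℤ₃ × F₄ with FROZEN steps (a single permutation, ℓ²-norm 1) at S-positions and the two branch
permutations P₀, P₁ at free positions, (P₁⁻¹P₀)³ = id; Fourier over σ ∈ ℤ₅^{K}: the a = 0 term is
the value of a FIXED fired se -/
@[route_item "route-QuantumAdvantage-OddPrimeWalk"]
def ColumnResolutionRungFive : Prop :=
  ∀ θ : ℝ, 2 / 3 < θ → ∃ C n₀ : ℕ, ∀ n ≥ n₀, ∀ c K : ℕ, ∀ S : Finset (Fin n), (∃ i : Fin n, i ∉ S) → ∀ κ : Fin n → Fin K, (∀ i : Fin n, i ∉ S → C * Nat.log 2 n ≤ (Finset.univ.filter fun i' : Fin n => i' ∉ S ∧ κ i' = κ i).card) → ∀ y : Fin (n + 1) → (Fin n → Bool) → Bool, (∀ g u u', (∀ i ∈ S, u i = u' i) → (∀ k : Fin K, ((((Finset.univ.filter fun i : Fin n => i ∉ S ∧ κ i = k ∧ u i = true).card : ℕ) : ZMod 5) = (((Finset.univ.filter fun i : Fin n => i ∉ S ∧ κ i = k ∧ u' i = true).card : ℕ) : ZMod 5))) → y g u = y g u') → ((Finset.univ.filter fun u : Fin n → Bool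 => Summit.QuantumAdvantage.AdviceFreeQNC0.ringWinU c y u = true).card : ℝ) ≤ θ * (2 : ℝ) ^ n

/-- `ColumnResolutionRungFive` holds: proved by `Summit.QuantumAdvantage.QuantumAdvantage.Theorems.oddPrimeWalk_columnResolutionRungFive`. -/
theorem ColumnResolutionRungFive_holds : ColumnResolutionRungFive := _root_.Summit.QuantumAdvantage.QuantumAdvantage.Theorems.oddPrimeWalk_columnResolutionRungFive

/-- item stmt-QuantumAdvantage-24323 · support · rank 9 · closed · proved by Summit.QuantumAdvantage.QuantumAdvantage.Theorems.oddPrimeWalk_fibreTwistBoundFive (prover) · by planner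
[support] TwistBound 5 ON A FIBRE (planner qa-qnc0-p2 g32, PROOF-MC §4; typed verbatim in
HOME/qa-qnc0-p2/line32/Sketch32c.lean, farm rc 0): with the bits in S pinned to π, the twisted
WIN-sum of an OBLIVIOUS firing set Y over the free bits is ≤ 3√6·cos(π/15)^{#(supp β off
S)}·2^{n−|S|}. Proof route: TwistedTransfer.corr_win_le with a deterministic single-branch (norm-1,
unimodular phase) step at each pinned site; free sites exactly as in twistBound 5
(TwoModuli.sum_norm_sq_twistStep_three_le). Size S/M. Serves stmt-24278 ColumnResolutionRungFive and
stmt-24257 MultiCounterRungFive: fibrewise Fourier expansion over the class counters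
(TwoModuli.sum_cell_eq_sum_twisted pattern) = a=0 term (PROOF-BB, per fibre) + Σ_{a≠0} |twisted
fibre sums| ≤ 3√6(Π_k(1+4ρ^{n_k})−1)·2^{n−|S|}. Why it might fail: it should not — degenerate cases
S = univ / β = 0 hold trivially; the only delicate point is the normalisation 2^{n−|S|} (free sites
contribute the factor 2 each). -/
@[route_item "route-QuantumAdvantage-OddPrimeWalk"]
def FibreTwistBoundFive : Prop :=
  ∀ (n c : ℕ) (S : Finset (Fin n)) (π : Fin n → Bool) (Y : Finset (Fin (n + 1))) (β : Fin n → ZMod 5), ‖∑ u ∈ (Finset.univ.filter fun u : Fin n → Bool => ∀ i ∈ S, u i = π i), (if Summit.QuantumAdvantage.AdviceFreeQNC0.ringWinU c (fun g _ => decide (g ∈ Y)) u = true then (1 : ℂ) else 0) * Complex.exp (2 * Real.pi * Complex.I * (((∑ i, if u i then β i else 0).val : ℝ) : ℂ) / (5 : ℂ))‖ ≤ 3 * Real.sqrt 6 * Real.cos (Real.pi / 15) ^ ((Finset.univ \ S).filter fun i => β i ≠ 0).card * (2 : ℝ) ^ (n - S.card)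

/-- `FibreTwistBoundFive` holds: proved by `Summit.QuantumAdvantage.QuantumAdvantage.Theorems.oddPrimeWalk_fibreTwistBoundFive`. -/
theorem FibreTwistBoundFive_holds : FibreTwistBoundFive := _root_.Summit.QuantumAdvantage.QuantumAdvantage.Theorems.oddPrimeWalk_fibreTwistBoundFive

/-- item stmt-QuantumAdvantage-24332 · support · rank 9 · closed · proved by Summit.QuantumAdvantage.QuantumAdvantage.Theorems.oddPrimeWalk_signWalkFloorThree (prover) · by planner
[support] SIGN-WALK FLOOR on ℤ₃ (planner qa-qnc0-p2 g32, PROOF-BB L2–L5;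
HOME/qa-qnc0-p2/line32/{PROOF-BB.md, BBCore.lean (constants + parity lemma kernel-checked, rc 0),
Sketch32d.lean}): for k fair bits with prefix counts z_j mod 3, every set A of active sites j ∈
[0,k] and targets x_j: Σ_b Π_{j∈A}(2[z_j + z_k = x_j] − 1) ≥ −(1/3+ε)2^k for k ≥ k₀(ε). NO ring-game
objects — pure combinatorics/linear algebra: parity lemma Σ_{w∈ℤ₃}Π_j(2[w=c_j]−1) ∈ {3,−1}
(BBCore.parity_sum), dense active sets: ‖P·diag(2δ_x−1)·P‖² ≤ ½ (BBCore.pgp_sq_le_half) ⇒ |·| ≤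
3λ^{(|A|−3)/2}2^k, sparse: a free gap of ≥ ℓ₀ bits is an independent 2^{−ℓ₀}-uniform shift entering
every factor linearly with independent forms f_i = (2,…,2,1,…,1) ⇒ factorisation into parity sums ⇒
≥ −1/3 − 2(s+1)2^{−ℓ₀}. Numerically verified (bb_floor.py k=14: min = −1/3 − 2.7·2^{−14};
bb_factor.py). Size M−. TOGETHER WITH the fibre/character reduction (−1)^{WIN} = Π_{active
gaps}(2[z_j+z_k ≡ x_j]−1) (L1, bookkeeping à la OddPrimeWalkThreeBlindBits) it gives stmt-24271
BoundedJuntaRungFive and the a=0 base of 24278/24257. Why it might fail: it should not (floor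
verified exhaustively for ends-only configurations k ≤ 14 and 400 random o -/
@[route_item "route-QuantumAdvantage-OddPrimeWalk"]
def SignWalkFloorThree : Prop :=
  ∀ ε : ℝ, 0 < ε → ∃ k₀ : ℕ, ∀ k ≥ k₀, ∀ A : Finset (Fin (k + 1)), ∀ x : Fin (k + 1) → ZMod 3, -(1 / 3 + ε) * (2 : ℝ) ^ k ≤ ∑ b : Fin k → Bool, ∏ j ∈ A, (if (((Finset.univ.filter fun i : Fin k => i.val < j.val ∧ b i = true).card : ℕ) : ZMod 3) + (((Finset.univ.filter fun i : Fin k => b i = true).card : ℕ) : ZMod 3) = x j then (1 : ℝ) else -1)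

/-- `SignWalkFloorThree` holds: proved by `Summit.QuantumAdvantage.QuantumAdvantage.Theorems.oddPrimeWalk_signWalkFloorThree`. -/
theorem SignWalkFloorThree_holds : SignWalkFloorThree := _root_.Summit.QuantumAdvantage.QuantumAdvantage.Theorems.oddPrimeWalk_signWalkFloorThree

/-- item stmt-QuantumAdvantage-25496 · support · rank 9 · open · by planner
sources: arXiv:1704.00690
[support] END-STRUCTURED REGISTER LAW for every prime p ≥ 5 and polylog-degree POLYNOMIAL data
(decomp-qadv cell, lens-4 g2 `EndStructuredHardAll`,
HOME/decomp-qadv-lens-4/RegisterNormalForm.lean:182 sha256 5021cc37…); generalises item 24199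
EndRegisterLawFive from (p = 5, L linear forms mod 5, bound 2/3+2δ) to (every prime p ≥ 5, L values
of degree-≤(log₂n)^C′ 𝔽_p-polynomials φ_k, bound θ₀+δ with θ₀ = 1−η₀(p) from one-sided elimination
elimHardF). HYPOTHESIS: off ≤ δ·2ⁿ inputs u the label-count register V_e(u) = #{g : y_g u ∧ (g +
wtPrefix u g) ≡ e mod 3} is END-STRUCTURED: parity of V_e + [A(first D bits, φ⃗(u), e)] + [B(last D
bits, φ⃗(u), (e + 2·wt u) mod 3)] independent of e ∈ range 3. CONCLUSION: #{u : ringWinU c y u} ≤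
(θ₀ + δ)·2ⁿ for n ≥ n₀(δ,C′,D,L), for EVERY strategy y (no degree hypothesis on y). PROVED (lean
check rc0, 0 sorry, 308 lines): HOME = run/shared/lean/pub/decomp-qadv/, file
decomp-qadv-lens-4/EndStructuredHardAllProof.lean sha256
0f0c84b687b8057269c9661a79093c2c599050a01057bdfbbc3aaa6e74e257c4, theorem
RegisterNormalFormProof.endStructuredHardAll (engine: elimHardF landed for p ≠ 3 +
OddConfig.win_iff_FwinN / exists_losing_class from Theorems/OddPrimeWalkEnd -/
@[route_item "route-QuantumAdvantage-OddPrimeWalk"]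
def EndStructuredHardAll : Prop :=
  ∀ (p : ℕ) [Fact p.Prime], 5 ≤ p → ∃ θ₀ : ℝ, θ₀ < 1 ∧ ∀ δ : ℝ, 0 < δ → ∀ C' D L : ℕ, ∃ n₀ : ℕ, ∀ n ≥ n₀, ∀ c : ℕ, ∀ y : Fin (n + 1) → (Fin n → Bool) → Bool, ∀ φ : Fin L → (Fin n → Bool) → ZMod p, (∀ k, φ k ∈ Literature.Computability.MetaComplexity.Smolensky.lowDeg (ZMod p) n ((Nat.log 2 n) ^ C')) → ∀ A B : (Fin n → Bool) → (Fin L → ZMod p) → ℕ → Bool, ((Finset.univ.filter fun u : Fin n → Bool => ¬ (∀ e ∈ Finset.range 3, ∀ e' ∈ Finset.range 3, ((Finset.univ.filter fun g : Fin (n + 1) => y g u = true ∧ (g.val + Summit.QuantumAdvantage.AdviceFreeQNC0.wtPrefix u g.val) % 3 = e).card + (if A (fun i => decide (i.val < D) && u i) (fun k => φ k u) e = true then 1 else 0) + (if B (fun i => decide (n ≤ i.val + D) && u i) (fun k => φ k u) ((e + 2 * Summit.QuantumAdvantage.AdviceFreeQNC0.wt u) % 3) = true then 1 else 0)) % 2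 = ((Finset.univ.filter fun g : Fin (n + 1) => y g u = true ∧ (g.val + Summit.QuantumAdvantage.AdviceFreeQNC0.wtPrefix u g.val) % 3 = e').card + (if A (fun i => decide (i.val < D) && u i) (fun k => φ k u) e' = true then 1 else 0) + (if B (fun i => decide (n ≤ i.val + D) && u i) (fun k => φ k u) ((e' + 2 * Summit.QuantumAdvantage.AdviceFreeQNC0.wt u) % 3) = true then 1 else 0)) % 2)).card : ℝ) ≤ δ * (2 : ℝ) ^ n → ((Finset.univ.filter fun u : Fin n → Bool => Summit.QuantumAdvantage.AdviceFreeQNC0.ringWinU c y u = true).card : ℝ) ≤ (θ₀ + δ) * (2 : ℝ) ^ n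

/-- item stmt-QuantumAdvantage-27289 · support · rank 9 · closed · proved by Summit.QuantumAdvantage.QuantumAdvantage.Theorems.oddPrimeWalk_hiddenCoinsFourOdd (prover) · by planner
[support, rung J_4 "hidden coins", instrument for cruxes ManyReadersSqrtOdd/DenseResidualSqrtOdd via
R11″] Every strategy all of whose cuts read only a common set J of input bits with |J|+4 ≤ n
(arbitrary tables, any complexity, any positions) wins the u-walk game ringWinU c on ≤ (3/4)·2ⁿ
inputs. Proof (ROUND-20 (p2) §2): fibre over the visible bits ⇒ the free-phase oblivious game G_4
(positions j=0..4 see V_j = wt x + wt x_{<j} mod 3, per position an optional [V≠a], XOR), whose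
value 12/16 is kernel-checked (Sketch20 `FreePhase.bound_four`, native_decide). Removes the polylog
junta-size restriction of walkHardFJunta (θ there 1−η₀/4). WHY IT MIGHT FAIL: only the reduction
bookkeeping (cut g lies after exactly #{i∈I: i<g} hidden coins; s_g = t_g(u_J)+V_{j(g)}(x));
validated numerically on the real game (exp20/check_reduction.py, max 12/16 attained). SOURCES:
arXiv:1906.08890 (WKST19 §2.2 restricted parity-halving game, nearest print), arXiv:2408.16378
(Lemma 54–55), Summit.QuantumAdvantage.AdviceFreeQNC0.walkHardFJunta -/
@[route_item "route-QuantumAdvantage-OddPrimeWalk"]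
def HiddenCoinsFourOdd : Prop :=
  ∀ n c : ℕ, ∀ J : Finset (Fin n), J.card + 4 ≤ n → ∀ y : Fin (n + 1) → (Fin n → Bool) → Bool, (∀ g, ∀ u v : Fin n → Bool, (∀ i ∈ J, u i = v i) → y g u = y g v) → ((Finset.univ.filter fun u : Fin n → Bool => Summit.QuantumAdvantage.AdviceFreeQNC0.ringWinU c y u = true).card : ℝ) ≤ (3 / 4 : ℝ) * (2 : ℝ) ^ n

/-- `HiddenCoinsFourOdd` holds: proved by `Summit.QuantumAdvantage.QuantumAdvantage.Theorems.oddPrimeWalk_hiddenCoinsFourOdd`. -/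
theorem HiddenCoinsFourOdd_holds : HiddenCoinsFourOdd := _root_.Summit.QuantumAdvantage.QuantumAdvantage.Theorems.oddPrimeWalk_hiddenCoinsFourOdd

/-- item stmt-QuantumAdvantage-27290 · support · rank 9 · closed · proved by Summit.QuantumAdvantage.QuantumAdvantage.Theorems.oddPrimeWalk_linFormsSqrtOdd (prover) · by planner
[support, rung R11″ = rank-√n linear forms, instrument for cruxes ManyReadersSqrtOdd (23109) /
DenseResidualSqrtOdd (23029)] For every prime p ≥ 5 there are θ < 1, κ > 0 such that for all large n
a strategy reading u only through K linear forms mod p with K² ≤ κ·n, with ARBITRARY tables per cut,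
wins the u-walk game ringWinU c on ≤ θ·2ⁿ inputs (up from K ≤ (log₂ n)^C in the tree theorem
walkHardFLinForms). Proof (ROUND-20 (p2) §3): tree LinForms.card_win_le with the junta J of
LinForms.exists_regular_span (|J| ≤ K·w), w := ⌈(K ln p + ln(3√6/η))/(−ln cos(π/3p))⌉ ≍ 18p²(K ln
p)/π², and the hidden-coins bound HiddenCoinsFourOdd (stmt-QuantumAdvantage-27289) as the junta
estimate once K·w + 4 ≤ n; θ = 3/4 + η. WHY IT MIGHT FAIL: only constants — K·w(K) ≤ n − 4 forces κ
≍ π²/(18 p² ln p) (0.0137 for p = 5); no new mechanism; the p^K wall (W2) is untouched (this is the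
LAST rung reachable by regularise–expand). SOURCES: doi:10.1109/ccc.2011.25 (Chattopadhyay–Lovett
2011 Thm 1), Summit.QuantumAdvantage.AdviceFreeQNC0.LinForms.card_win_le,
Summit.QuantumAdvantage.AdviceFreeQNC0.walkHardFLinForms, arXiv:1906.08890 -/
@[route_item "route-QuantumAdvantage-OddPrimeWalk"]
def LinFormsSqrtOdd : Prop :=
  ∀ (p : ℕ) [Fact p.Prime], 5 ≤ p → ∃ θ : ℝ, θ < 1 ∧ ∃ κ : ℝ, 0 < κ ∧ ∃ n₀ : ℕ, ∀ n ≥ n₀, ∀ c K : ℕ, (K : ℝ) ^ 2 ≤ κ * n → ∀ lam : Fin K → Fin n → ZMod p, ∀ tab : Fin (n + 1) → (Fin K → ZMod p) → Bool, ((Finset.univ.filter fun u : Fin n → Bool => Summit.QuantumAdvantage.AdviceFreeQNC0.ringWinU c (fun g v => tab g (fun j => Finset.univ.sum fun i : Fin n => if v i then lam j i else 0)) u = true).card : ℝ) ≤ θ * (2 : ℝ) ^ n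

/-- `LinFormsSqrtOdd` holds: proved by `Summit.QuantumAdvantage.QuantumAdvantage.Theorems.oddPrimeWalk_linFormsSqrtOdd`. -/
theorem LinFormsSqrtOdd_holds : LinFormsSqrtOdd := _root_.Summit.QuantumAdvantage.QuantumAdvantage.Theorems.oddPrimeWalk_linFormsSqrtOdd

/-- item stmt-QuantumAdvantage-28072 · support · rank 9 · closed · proved by Summit.QuantumAdvantage.AdviceFreeQNC0.Coset21.RungG.twoStepFiniteStateWalkHard_five (prover) · by planner
[support] rung (G): 2-step finite-state strategies (tests factor through (wtPrefix u g, wt u) mod p)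
win the u-walk game with probability ≤ 2/3 + ε for large n, p = 5. Checked skeleton
HOME/qa-qnc0-p2/line22/RungG.lean (4 stubs: Equidist, SparseBound, Contraction, DenseBound;
composition kernel-checked); proof card line21/RUNG-G.md. Inside HasDegF (degree ≤ 2(p−1)); strictly
between M19 (counters) and R5 (LinSel); why it might fail: only if the window/contraction
bookkeeping hides a gap — all four stub statements hand-verified incl. edge cases; sources: cell
ROUND-21 §6 (G), ROUND-22 §1. -/
@[route_item "route-QuantumAdvantage-OddPrimeWalk"]
def FiniteStateRungFive : Prop :=
  Summit.QuantumAdvantage.AdviceFreeQNC0.Coset21.TwoStepFiniteStateWalkHard 5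

/-- `FiniteStateRungFive` holds: proved by `Summit.QuantumAdvantage.AdviceFreeQNC0.Coset21.RungG.twoStepFiniteStateWalkHard_five`. -/
theorem FiniteStateRungFive_holds : FiniteStateRungFive := _root_.Summit.QuantumAdvantage.AdviceFreeQNC0.Coset21.RungG.twoStepFiniteStateWalkHard_five

/-- item stmt-QuantumAdvantage-22735 · assembly · rank 1 · closed · proved by Summit.QuantumAdvantage.QuantumAdvantage.Theorems.assembly_proof (prover) · by planner
sources: arXiv:1704.00690
[assembly] ShotsOdd → DenseResidualOdd → DichotomyGlue → BridgeOdd → the rung leaf (∀ p ≥ 5 prime,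
AdviceFreeQNC0Sep p). -/
@[route_item "route-QuantumAdvantage-OddPrimeWalk"]
def Assembly : Prop :=
  ShotsOdd → DenseResidualOdd → DichotomyGlue → BridgeOdd → ∀ (p : ℕ) [Fact p.Prime], 5 ≤ p → Summit.QuantumAdvantage.AdviceFreeQNC0.AdviceFreeQNC0Sep p

-- `Assembly` holds: proved by `Summit.QuantumAdvantage.QuantumAdvantage.Theorems.assembly_proof` (its module imports this route file, so no `_holds` link can be stated here).

/-! D-0027 §2.1 — DECIDING THEOREM (planner-authored via `route open/edit --closes-file`; by planner-qa-qnc0-p2-g15-0 2026-08-27T22:00:52Z):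
its hypotheses are this route's items and its conclusion the registered leaf `Summit.QuantumAdvantage.AdviceFreeQNC0.AdviceFreeQNC0Odd` (rung F-Q1-odd, D-0061) (glue_lint), and it elaborates with this file. -/

@[closes "route-QuantumAdvantage-OddPrimeWalk"] theorem closes (hSh : ShotsOdd) (hR : DenseResidualOdd) (hG : DichotomyGlue) (hB : BridgeOdd) :
    Summit.QuantumAdvantage.AdviceFreeQNC0.AdviceFreeQNC0Odd :=
  fun p _ hp => hB p hp (hG hSh hR p hp)

end Summit.QuantumAdvantage.QuantumAdvantage.Theses.OddPrimeWalk
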